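import Mathlib
import Literature.NumberTheory.Automorphic.UnitaryGroupFormTransport
import HarnessLib

/-!
# Characters of isotropic unitary groups kill the determinant-one subgroup — EVERY finite rank

Topic `NumberTheory/Automorphic`; namespace `Literature.NumberTheory.Automorphic.UnitaryIsotropic`.  KERNEL only
(theorems, no definition, no notation, no named fact, no `sorry`).  The general-rank form of the tree's rank-3 engine
✔ `UnitaryRankThree*` (`UnitaryRankThree.apply_eq_one_of_det_eq_one_diagonal'`, [Dieudonne1971GroupesClassiques, Chap. II §5]
for the rank-3 Witt-index-1 frame by explicit `3 × 3` matrices).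

**Main theorem** (`apply_eq_one_of_det_eq_one`, §13).  `K` a field with `2 ≠ 0`, `σ : K →+* K` an involution with
`σ θ₀ = −θ₀ ≠ 0` (so `σ ≠ 1`), `J ∈ M_n(K)` (`n` ANY finite type) `σ`-hermitian (`ᵗσ(J) = J`), non-degenerate (`det J ≠ 0`)
and admitting an isotropic vector (`ᵗσ(x) J x = 0`, `x ≠ 0`).  Then EVERY homomorphism `χ : unitaryGroupOfForm σ J →* A` to a
commutative group kills every element of determinant `1`: `SU(J) ≤ ker χ`, i.e. `χ` factors through `det`.  This is the
commutative-field case of Dieudonné's theorem `SU_n(K, f) = T_n(K, f) ≤ U_n(K, f)'` for hermitian forms of index `≥ 1`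
[Dieudonne1971GroupesClassiques, Chap. II §5], in the form the tree consumes (characters of `U(V)(F_v)` at a non-split place,
`V` of rank `≥ 3` hence isotropic — ✔ `QuadraticForms/HermitianLocalIsotropy`).

**Route** (abstract form `chi_eq_one_of_det_eq_one`, §12, on a finite-dimensional `V` with a sesquilinear
`B : V →ₛₗ[σ] V →ₗ[K] K`, hermitian `σ (B x y) = B y x`, and a function `χ : End V → A` multiplicative on isometries; strong
induction on `dim V`):
* §3 quasi-symmetries `Q(a, μ) = 1 + ((μ−1)/B a a)·(B a) ⊗ a` (`σμ·μ = 1`): isometries, `det = μ`, `Q(a,μ)Q(a,μ') = Q(a,μμ')`,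
  `g Q(a,μ) g⁻¹ = Q(g a, μ)`;
* §4 root elements `T(u, w, z) = 1 + (B u) ⊗ w + (z B u − B w) ⊗ u` (`u` isotropic, `w ⊥ u`, `z + σz + B w w = 0`):
  isometries of determinant `1`, product ∕ inverse ∕ conjugation formulas; §5 a hyperbolic pair `e, f` (`B e f = θ₀`), the
  decomposition `V = {e,f}^⊥ ⊕ (K e + K f)`, the dilations `D(α)` (`e ↦ αe`, `f ↦ (σα)⁻¹f`, `det = α(σα)⁻¹`);
* §6 `χ` kills transvections and root elements (commutators with `D(β)`, `σβ·β ≠ 1`, and with `D(−1)`; uses `2 ≠ 0`);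
* §7 the hyperbolic plane: `χ D(α) = 1` for `σα = α` by the `SL₂(K^σ)` identity `D(α)·U(1)L(1)U(1) = U(α)L(α⁻¹)U(α)`;
  isometries fixing `{e,f}^⊥` are `transvections · D(p) · transvection`, so on them `χ` depends only on `det`;
* §8 extension of endomorphisms of a complemented submodule by the identity (`det` and isometry preserved);
* §9 one root element moves an isotropic vector with non-zero `u`-coordinate onto `K u'`; hence `g ↦ D(p)·ι(h)` with
  `h ∈ U({e,f}^⊥)` after left multiplication by at most four root elements;
* §10 the ANISOTROPIC Cartan–Dieudonné theorem (every isometry of an anisotropic space is a product of quasi-symmetries,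
  [Dieudonne1971GroupesClassiques, Chap. II §4]); §11 a quasi-symmetry on `a ∈ {e,f}^⊥` is `χ`-equivalent to one on
  `x = e + (B a a/2θ₀) f` in the hyperbolic plane (conjugate by the symmetry along `x − a`);
* §12 the induction: `{e,f}^⊥` isotropic ⇒ induction hypothesis; anisotropic ⇒ §10 + §11; §13 the matrix dress via
  `Matrix.toLinearMapₛₗ₂'` ∕ `Matrix.toLin'` (`unitaryGroupOfForm` of ✔ `UnitaryGroupAutomorphicRep`, cited not restated).

Written for the pub-hodgecm2 (COR-CM) audit of [Liu2021, App. D Lemma D.1 (3)] at ranks `N ≥ 4` (seat prover-pub-hodgecm2-b10);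
nothing here is specific to number fields.  HC_CM is NOT proved.

## References

* J. Dieudonné, *La géométrie des groupes classiques*, 3e éd., Springer (1971), Chap. II §§4–5
  [Dieudonne1971GroupesClassiques].
-/

set_option autoImplicit false

universe u

namespace Literature.NumberTheory.Automorphic

namespace UnitaryIsotropic

variable {K : Type*} [Field K] {σ : K →+* K} {V : Type*} [AddCommGroup V] [Module K V]

/-! ## §1 Sesquilinear bookkeeping -/

/-- `B (c • x) y = σ c * B x y`. [folklore] -/
private theorem apply_smul_left (B : V →ₛₗ[σ] V →ₗ[K] K) (c : K) (x y : V) : B (c • x) y = σ c * B x y := by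
  rw [LinearMap.map_smulₛₗ, LinearMap.smul_apply, smul_eq_mul]

/-- `B x (c • y) = c * B x y`. [folklore] -/
private theorem apply_smul_right (B : V →ₛₗ[σ] V →ₗ[K] K) (c : K) (x y : V) : B x (c • y) = c * B x y := by
  rw [map_smul, smul_eq_mul]

/-- `B (x + x') y = B x y + B x' y`. [folklore] -/
private theorem apply_add_left (B : V →ₛₗ[σ] V →ₗ[K] K) (x x' y : V) : B (x + x') y = B x y + B x' y := by
  rw [map_add, LinearMap.add_apply]

/-- `B (x - x') y = B x y - B x' y`. [folklore] -/
private theorem apply_sub_left (B : V →ₛₗ[σ] V →ₗ[K] K) (x x' y : V) : B (x - x') y = B x y - B x' y := by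
  rw [map_sub, LinearMap.sub_apply]

/-- `B (-x) y = - B x y`. [folklore] -/
private theorem apply_neg_left (B : V →ₛₗ[σ] V →ₗ[K] K) (x y : V) : B (-x) y = -B x y := by
  rw [map_neg, LinearMap.neg_apply]

/-- For a hermitian form, `B x y = 0 → B y x = 0`. [folklore] -/
private theorem apply_eq_zero_comm (B : V →ₛₗ[σ] V →ₗ[K] K) (hB : ∀ x y, σ (B x y) = B y x) {x y : V}
    (h : B x y = 0) : B y x = 0 := by
  rw [← hB x y, h, map_zero]

/-! ## §2 The rank-one determinant lemma -/

section Det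

variable [FiniteDimensional K V]

/-- **`det (1 + φ ⊗ v) = 1 + φ v`** (matrix determinant lemma, read on `Module.End K V`). [folklore] -/
private theorem det_one_add_smulRight (φ : V →ₗ[K] K) (v : V) :
    LinearMap.det ((1 : Module.End K V) + φ.smulRight v) = 1 + φ v := by
  classical
  let b := Module.finBasis K V
  rw [← LinearMap.det_toMatrix b]
  have hM : LinearMap.toMatrix b b ((1 : Module.End K V) + φ.smulRight v) =
      1 + Matrix.replicateCol Unit (b.repr v) * Matrix.replicateRow Unit (fun j => φ (b j)) := by
    rw [map_add, LinearMap.toMatrix_one]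
    congr 1
    ext i j
    rw [LinearMap.toMatrix_apply, LinearMap.smulRight_apply, map_smul, Finsupp.smul_apply, smul_eq_mul,
      Matrix.mul_apply]
    simp [Matrix.replicateCol_apply, Matrix.replicateRow_apply, mul_comm]
  rw [hM, Matrix.det_one_add_replicateCol_mul_replicateRow, dotProduct]
  congr 1
  conv_rhs => rw [← b.sum_repr v]
  rw [map_sum]
  refine Finset.sum_congr rfl fun j _ => ?_
  rw [map_smul, smul_eq_mul, mul_comm]

/-- `det (1 + c • φ ⊗ v) = 1 + c * φ v`. [folklore] -/
private theorem det_one_add_smul_smulRight (c : K) (φ : V →ₗ[K] K) (v : V) :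
    LinearMap.det ((1 : Module.End K V) + c • φ.smulRight v) = 1 + c * φ v := by
  have h : c • φ.smulRight v = (c • φ).smulRight v := by
    ext x
    simp only [LinearMap.smul_apply, LinearMap.smulRight_apply, smul_smul, smul_eq_mul]
  rw [h, det_one_add_smulRight, LinearMap.smul_apply, smul_eq_mul]

end Det

/-! ## §3 Quasi-symmetries `Q(a, μ) = 1 + ((μ - 1)/B a a) • (B a) ⊗ a` -/

/-- `Q(a, μ) y = y + ((μ - 1) (B a a)⁻¹ B a y) • a`. [folklore] -/
private theorem quasi_apply (B : V →ₛₗ[σ] V →ₗ[K] K) (a : V) (μ : K) (y : V) :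
    ((1 : Module.End K V) + ((μ - 1) * (B a a)⁻¹) • (B a).smulRight a) y =
      y + ((μ - 1) * (B a a)⁻¹ * B a y) • a := by
  simp only [LinearMap.add_apply, Module.End.one_apply, LinearMap.smul_apply, LinearMap.smulRight_apply,
    smul_smul]

/-- `Q(a, μ) a = μ • a` (`B a a ≠ 0`). [folklore] -/
private theorem quasi_apply_self (B : V →ₛₗ[σ] V →ₗ[K] K) (a : V) (ha : B a a ≠ 0) (μ : K) :
    ((1 : Module.End K V) + ((μ - 1) * (B a a)⁻¹) • (B a).smulRight a) a = μ • a := by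
  rw [quasi_apply, inv_mul_cancel_right₀ ha]
  nth_rw 1 [← one_smul K a]
  rw [← add_smul, add_sub_cancel]

/-- `Q(a, μ) y = y` for `y ⊥ a`. [folklore] -/
private theorem quasi_apply_of_orth (B : V →ₛₗ[σ] V →ₗ[K] K) (a : V) (μ : K) {y : V} (hy : B a y = 0) :
    ((1 : Module.End K V) + ((μ - 1) * (B a a)⁻¹) • (B a).smulRight a) y = y := by
  rw [quasi_apply, hy, mul_zero, zero_smul, add_zero]

/-- **Quasi-symmetries are isometries**: for a hermitian `B`, `B a a ≠ 0` and `σ μ · μ = 1`,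
`B (Q x) (Q y) = B x y`. [cite: Dieudonne1971GroupesClassiques, Chap. II §4] -/
theorem quasi_isometry (B : V →ₛₗ[σ] V →ₗ[K] K) (hB : ∀ x y, σ (B x y) = B y x) (a : V) (ha : B a a ≠ 0)
    (μ : K) (hμ : σ μ * μ = 1) (x y : V) :
    B (((1 : Module.End K V) + ((μ - 1) * (B a a)⁻¹) • (B a).smulRight a) x)
      (((1 : Module.End K V) + ((μ - 1) * (B a a)⁻¹) • (B a).smulRight a) y) = B x y := by
  have haa : σ (B a a) = B a a := hB a a
  have hxa : B x a = σ (B a x) := (hB a x).symm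
  rw [quasi_apply, quasi_apply, apply_add_left, map_add, map_add, apply_smul_left, apply_smul_left,
    apply_smul_right, apply_smul_right, hxa]
  simp only [map_mul, map_sub, map_one, map_inv₀, haa]
  have key : (μ - 1) * (B a a)⁻¹ + (σ μ - 1) * (B a a)⁻¹ +
      (σ μ - 1) * (B a a)⁻¹ * ((μ - 1) * (B a a)⁻¹) * B a a = 0 := by
    field_simp
    linear_combination hμ
  linear_combination (σ (B a x) * B a y) * key

section QDet

variable [FiniteDimensional K V]

/-- **`det Q(a, μ) = μ`** (`B a a ≠ 0`). [cite: Dieudonne1971GroupesClassiques, Chap. II §4] -/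
theorem det_quasi (B : V →ₛₗ[σ] V →ₗ[K] K) (a : V) (ha : B a a ≠ 0) (μ : K) :
    LinearMap.det ((1 : Module.End K V) + ((μ - 1) * (B a a)⁻¹) • (B a).smulRight a) = μ := by
  rw [det_one_add_smul_smulRight, inv_mul_cancel_right₀ ha, add_sub_cancel]

end QDet

/-- `Q(a, μ) * Q(a, μ') = Q(a, μ μ')`. [cite: Dieudonne1971GroupesClassiques, Chap. II §4] -/
theorem quasi_mul_quasi (B : V →ₛₗ[σ] V →ₗ[K] K) (a : V) (ha : B a a ≠ 0) (μ μ' : K) :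
    ((1 : Module.End K V) + ((μ - 1) * (B a a)⁻¹) • (B a).smulRight a) *
        ((1 : Module.End K V) + ((μ' - 1) * (B a a)⁻¹) • (B a).smulRight a) =
      (1 : Module.End K V) + ((μ * μ' - 1) * (B a a)⁻¹) • (B a).smulRight a := by
  ext y
  rw [Module.End.mul_apply, quasi_apply, quasi_apply, quasi_apply, map_add, apply_smul_right, add_assoc,
    ← add_smul]
  congr 2
  field_simp
  ring

/-- `Q(a, 1) = 1`. [folklore] -/
private theorem quasi_one (B : V →ₛₗ[σ] V →ₗ[K] K) (a : V) :
    ((1 : Module.End K V) + (((1 : K) - 1) * (B a a)⁻¹) • (B a).smulRight a) = 1 := by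
  rw [sub_self, zero_mul, zero_smul, add_zero]

/-- **Conjugation**: for an isometry `g` with `g g' = 1`, `g Q(a, μ) g' = Q(g a, μ)`.
[cite: Dieudonne1971GroupesClassiques, Chap. II §4] -/
theorem conj_quasi (B : V →ₛₗ[σ] V →ₗ[K] K) (g g' : Module.End K V) (hg : ∀ x y, B (g x) (g y) = B x y)
    (hgg' : g * g' = 1) (a : V) (μ : K) :
    g * ((1 : Module.End K V) + ((μ - 1) * (B a a)⁻¹) • (B a).smulRight a) * g' =
      (1 : Module.End K V) + ((μ - 1) * (B (g a) (g a))⁻¹) • (B (g a)).smulRight (g a) := by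
  ext y
  have hy : g (g' y) = y := by rw [← Module.End.mul_apply, hgg', Module.End.one_apply]
  rw [Module.End.mul_apply, Module.End.mul_apply, quasi_apply, quasi_apply, map_add, map_smul, hy, hg]
  congr 2
  conv_rhs => rw [← hy]
  rw [hg]


/-! ## §4 Root elements `T(u, w, z) = 1 + (B u) ⊗ w + (z B u − B w) ⊗ u` (`u` isotropic, `w ⊥ u`) -/

/-- `T(u, w, z) y = y + (B u y) • w + (z B u y − B w y) • u`. [folklore] -/
private theorem root_apply (B : V →ₛₗ[σ] V →ₗ[K] K) (u w : V) (z : K) (y : V) :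
    ((1 : Module.End K V) + (B u).smulRight w + (z • B u - B w).smulRight u) y =
      y + B u y • w + (z * B u y - B w y) • u := by
  simp only [LinearMap.add_apply, Module.End.one_apply, LinearMap.smulRight_apply, LinearMap.sub_apply,
    LinearMap.smul_apply, smul_eq_mul]

/-- `T(u, w, z) u = u`. [folklore] -/
private theorem root_apply_self (B : V →ₛₗ[σ] V →ₗ[K] K) (hB : ∀ x y, σ (B x y) = B y x) (u w : V) (z : K)
    (hu : B u u = 0) (huw : B u w = 0) :
    ((1 : Module.End K V) + (B u).smulRight w + (z • B u - B w).smulRight u) u = u := by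
  rw [root_apply, hu, apply_eq_zero_comm B hB huw, mul_zero, sub_zero, zero_smul, zero_smul, add_zero, add_zero]

/-- `T(u, w, z) y = y` for `y ⊥ u, w`. [folklore] -/
private theorem root_apply_of_orth (B : V →ₛₗ[σ] V →ₗ[K] K) (u w : V) (z : K) {y : V} (huy : B u y = 0)
    (hwy : B w y = 0) :
    ((1 : Module.End K V) + (B u).smulRight w + (z • B u - B w).smulRight u) y = y := by
  rw [root_apply, huy, hwy, mul_zero, sub_zero, zero_smul, zero_smul, add_zero, add_zero]

/-- `T(u, 0, z) y = y + (z B u y) • u` (a transvection). [folklore] -/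
private theorem transv_apply (B : V →ₛₗ[σ] V →ₗ[K] K) (u : V) (z : K) (y : V) :
    ((1 : Module.End K V) + (B u).smulRight (0 : V) + (z • B u - B (0 : V)).smulRight u) y =
      y + (z * B u y) • u := by
  rw [root_apply, map_zero, LinearMap.zero_apply, sub_zero, smul_zero, add_zero]

/-- **Root elements are isometries**: `B u u = 0`, `B u w = 0`, `z + σ z + B w w = 0` ⇒
`B (T x) (T y) = B x y`. [cite: Dieudonne1971GroupesClassiques, Chap. II §5] -/
theorem root_isometry (B : V →ₛₗ[σ] V →ₗ[K] K) (hB : ∀ x y, σ (B x y) = B y x) (u w : V) (z : K)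
    (hu : B u u = 0) (huw : B u w = 0) (hz : z + σ z + B w w = 0) (x y : V) :
    B (((1 : Module.End K V) + (B u).smulRight w + (z • B u - B w).smulRight u) x)
      (((1 : Module.End K V) + (B u).smulRight w + (z • B u - B w).smulRight u) y) = B x y := by
  have hwu : B w u = 0 := apply_eq_zero_comm B hB huw
  have hxw : B x w = σ (B w x) := (hB w x).symm
  have hxu : B x u = σ (B u x) := (hB u x).symm
  rw [root_apply, root_apply]
  simp only [map_add, map_sub, LinearMap.map_smulₛₗ, map_smul, LinearMap.add_apply,
    LinearMap.smul_apply, smul_eq_mul, map_mul, hu, huw, hwu, hxw, hxu]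
  linear_combination (σ (B u x) * B u y) * hz

/-- `T(u, w, z) = (1 + (B u) ⊗ w) (1 + (z B u − B w) ⊗ u)` for `B u u = 0`. [folklore] -/
private theorem root_eq_mul (B : V →ₛₗ[σ] V →ₗ[K] K) (u w : V) (z : K) (hu : B u u = 0) :
    ((1 : Module.End K V) + (B u).smulRight w + (z • B u - B w).smulRight u) =
      ((1 : Module.End K V) + (B u).smulRight w) * ((1 : Module.End K V) + (z • B u - B w).smulRight u) := by
  ext y
  rw [root_apply, Module.End.mul_apply]
  simp only [LinearMap.add_apply, Module.End.one_apply, LinearMap.smulRight_apply, LinearMap.sub_apply,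
    LinearMap.smul_apply, smul_eq_mul, map_add, map_smul, hu, zero_smul, add_zero]

section RootDet

variable [FiniteDimensional K V]

/-- **`det T(u, w, z) = 1`** (`B u u = 0`, `B u w = 0`). [cite: Dieudonne1971GroupesClassiques, Chap. II §5] -/
theorem det_root (B : V →ₛₗ[σ] V →ₗ[K] K) (hB : ∀ x y, σ (B x y) = B y x) (u w : V) (z : K)
    (hu : B u u = 0) (huw : B u w = 0) :
    LinearMap.det ((1 : Module.End K V) + (B u).smulRight w + (z • B u - B w).smulRight u) = 1 := by
  rw [root_eq_mul B u w z hu, map_mul, det_one_add_smulRight, det_one_add_smulRight, huw,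
    LinearMap.sub_apply, LinearMap.smul_apply, hu, apply_eq_zero_comm B hB huw, smul_zero, sub_zero, add_zero,
    mul_one]

end RootDet

/-- **Product of root elements on the same isotropic vector**:
`T(u, w, z) T(u, w', z') = T(u, w + w', z + z' − B w w')`. [cite: Dieudonne1971GroupesClassiques, Chap. II §5] -/
theorem root_mul_root (B : V →ₛₗ[σ] V →ₗ[K] K) (hB : ∀ x y, σ (B x y) = B y x) (u w w' : V) (z z' : K)
    (hu : B u u = 0) (huw : B u w = 0) (huw' : B u w' = 0) :
    ((1 : Module.End K V) + (B u).smulRight w + (z • B u - B w).smulRight u) *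
        ((1 : Module.End K V) + (B u).smulRight w' + (z' • B u - B w').smulRight u) =
      (1 : Module.End K V) + (B u).smulRight (w + w') + ((z + z' - B w w') • B u - B (w + w')).smulRight u := by
  have hwu : B w u = 0 := apply_eq_zero_comm B hB huw
  ext y
  rw [Module.End.mul_apply, root_apply, root_apply, root_apply]
  simp only [map_add, map_smul, LinearMap.add_apply, smul_eq_mul, hu, huw', hwu, mul_zero, add_zero]
  module

/-- `T(u, 0, 0) = 1`. [folklore] -/
private theorem root_zero (B : V →ₛₗ[σ] V →ₗ[K] K) (u : V) :
    ((1 : Module.End K V) + (B u).smulRight (0 : V) + ((0 : K) • B u - B (0 : V)).smulRight u) = 1 := by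
  ext y
  rw [transv_apply, zero_mul, zero_smul, add_zero, Module.End.one_apply]

/-- **Conjugation**: for an isometry `g` with `g g' = 1`, `g T(u, w, z) g' = T(g u, g w, z)`.
[cite: Dieudonne1971GroupesClassiques, Chap. II §5] -/
theorem conj_root (B : V →ₛₗ[σ] V →ₗ[K] K) (g g' : Module.End K V) (hg : ∀ x y, B (g x) (g y) = B x y)
    (hgg' : g * g' = 1) (u w : V) (z : K) :
    g * ((1 : Module.End K V) + (B u).smulRight w + (z • B u - B w).smulRight u) * g' =
      (1 : Module.End K V) + (B (g u)).smulRight (g w) + (z • B (g u) - B (g w)).smulRight (g u) := by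
  ext y
  have hy : g (g' y) = y := by rw [← Module.End.mul_apply, hgg', Module.End.one_apply]
  rw [Module.End.mul_apply, Module.End.mul_apply, root_apply, root_apply, map_add, map_add, map_smul, map_smul, hy]
  have h1 : B u (g' y) = B (g u) y := by conv_rhs => rw [← hy]; rw [hg]
  have h2 : B w (g' y) = B (g w) y := by conv_rhs => rw [← hy]; rw [hg]
  rw [h1, h2]

/-- **Inverse**: `T(u, w, z) T(u, −w, σ z) = 1` for an admissible `(w, z)`. [folklore] -/
private theorem root_mul_root_neg (B : V →ₛₗ[σ] V →ₗ[K] K) (hB : ∀ x y, σ (B x y) = B y x) (u w : V) (z : K)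
    (hu : B u u = 0) (huw : B u w = 0) (hz : z + σ z + B w w = 0) :
    ((1 : Module.End K V) + (B u).smulRight w + (z • B u - B w).smulRight u) *
        ((1 : Module.End K V) + (B u).smulRight (-w) + (σ z • B u - B (-w)).smulRight u) = 1 := by
  rw [root_mul_root B hB u w (-w) z (σ z) hu huw (by rw [map_neg, huw, neg_zero])]
  have h0 : z + σ z - B w (-w) = 0 := by rw [map_neg, sub_neg_eq_add]; exact hz
  ext y
  rw [root_apply, Module.End.one_apply, add_neg_cancel, h0, map_zero, LinearMap.zero_apply, zero_mul, sub_zero,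
    smul_zero, zero_smul, add_zero, add_zero]

/-! ## §5 Hyperbolic pairs: decomposition along `e, f` and the pointwise-fixed complement -/

/-- `B f e = −θ₀`. [folklore] -/
private theorem apply_fe (B : V →ₛₗ[σ] V →ₗ[K] K) (hB : ∀ x y, σ (B x y) = B y x) {e f : V} {θ₀ : K}
    (hef : B e f = θ₀) (hθ : σ θ₀ = -θ₀) : B f e = -θ₀ := by rw [← hB e f, hef, hθ]

/-- **Decomposition**: `y + (B f y / θ₀) e − (B e y / θ₀) f` is orthogonal to `e` and to `f`. [folklore] -/
private theorem proj_orth (B : V →ₛₗ[σ] V →ₗ[K] K) (hB : ∀ x y, σ (B x y) = B y x) {e f : V} {θ₀ : K}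
    (he : B e e = 0) (hf : B f f = 0) (hef : B e f = θ₀) (hθ : σ θ₀ = -θ₀) (hθ0 : θ₀ ≠ 0) (y : V) :
    B e (y + (B f y * θ₀⁻¹) • e - (B e y * θ₀⁻¹) • f) = 0 ∧
      B f (y + (B f y * θ₀⁻¹) • e - (B e y * θ₀⁻¹) • f) = 0 := by
  have hfe := apply_fe B hB hef hθ
  constructor
  · rw [map_sub, map_add, apply_smul_right, apply_smul_right, he, hef, mul_zero, add_zero,
      inv_mul_cancel_right₀ hθ0, sub_self]
  · rw [map_sub, map_add, apply_smul_right, apply_smul_right, hf, hfe, mul_zero, sub_zero, mul_neg,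
      inv_mul_cancel_right₀ hθ0, add_neg_cancel]

/-- **Extensionality along a hyperbolic pair**: two endomorphisms agreeing on `e`, on `f` and on `{e, f}^⊥`
are equal. [folklore] -/
private theorem ext_of_pair (B : V →ₛₗ[σ] V →ₗ[K] K) (hB : ∀ x y, σ (B x y) = B y x) {e f : V} {θ₀ : K}
    (he : B e e = 0) (hf : B f f = 0) (hef : B e f = θ₀) (hθ : σ θ₀ = -θ₀) (hθ0 : θ₀ ≠ 0)
    (T₁ T₂ : Module.End K V) (h₁ : T₁ e = T₂ e) (h₂ : T₁ f = T₂ f)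
    (h₃ : ∀ w, B e w = 0 → B f w = 0 → T₁ w = T₂ w) : T₁ = T₂ := by
  ext y
  obtain ⟨h1, h2⟩ := proj_orth B hB he hf hef hθ hθ0 y
  have hw := h₃ _ h1 h2
  rw [map_sub, map_add, map_smul, map_smul, map_sub, map_add, map_smul, map_smul, h₁, h₂] at hw
  calc T₁ y = (T₁ y + (B f y * θ₀⁻¹) • T₂ e - (B e y * θ₀⁻¹) • T₂ f) - (B f y * θ₀⁻¹) • T₂ e +
      (B e y * θ₀⁻¹) • T₂ f := by abel
    _ = (T₂ y + (B f y * θ₀⁻¹) • T₂ e - (B e y * θ₀⁻¹) • T₂ f) - (B f y * θ₀⁻¹) • T₂ e +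
      (B e y * θ₀⁻¹) • T₂ f := by rw [hw]
    _ = T₂ y := by abel

/-- **The complement `{e, f}^⊥` is non-degenerate**: a vector orthogonal to `e`, `f` and to `{e, f}^⊥` is `0`
(`B` non-degenerate). [folklore] -/
private theorem eq_zero_of_orth (B : V →ₛₗ[σ] V →ₗ[K] K) (hB : ∀ x y, σ (B x y) = B y x)
    (hBnd : ∀ x, (∀ y, B x y = 0) → x = 0) {e f : V} {θ₀ : K}
    (he : B e e = 0) (hf : B f f = 0) (hef : B e f = θ₀) (hθ : σ θ₀ = -θ₀) (hθ0 : θ₀ ≠ 0)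
    (x : V) (hxe : B e x = 0) (hxf : B f x = 0) (hx : ∀ w, B e w = 0 → B f w = 0 → B x w = 0) : x = 0 := by
  refine hBnd x fun y => ?_
  obtain ⟨h1, h2⟩ := proj_orth B hB he hf hef hθ hθ0 y
  have hw := hx _ h1 h2
  rw [map_sub, map_add, apply_smul_right, apply_smul_right, apply_eq_zero_comm B hB hxe,
    apply_eq_zero_comm B hB hxf, mul_zero, mul_zero, add_zero, sub_zero] at hw
  exact hw

/-- A vector orthogonal to `{e, f}^⊥` lies in the span of `e, f`: `x = −(B f x/θ₀) e + (B e x/θ₀) f`. [folklore] -/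
private theorem eq_pair_of_orth (B : V →ₛₗ[σ] V →ₗ[K] K) (hB : ∀ x y, σ (B x y) = B y x)
    (hBnd : ∀ x, (∀ y, B x y = 0) → x = 0) {e f : V} {θ₀ : K}
    (he : B e e = 0) (hf : B f f = 0) (hef : B e f = θ₀) (hθ : σ θ₀ = -θ₀) (hθ0 : θ₀ ≠ 0) (x : V)
    (hx : ∀ w, B e w = 0 → B f w = 0 → B x w = 0) :
    x = (-(B f x * θ₀⁻¹)) • e + (B e x * θ₀⁻¹) • f := by
  obtain ⟨h1, h2⟩ := proj_orth B hB he hf hef hθ hθ0 x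
  have h0 := eq_zero_of_orth B hB hBnd he hf hef hθ hθ0 _ h1 h2 fun w hw1 hw2 => by
    rw [map_sub, map_add, LinearMap.sub_apply, LinearMap.add_apply, LinearMap.map_smulₛₗ,
      LinearMap.map_smulₛₗ, LinearMap.smul_apply, LinearMap.smul_apply, hx w hw1 hw2, hw1, hw2, smul_zero,
      smul_zero, add_zero, sub_zero]
  calc x = (x + (B f x * θ₀⁻¹) • e - (B e x * θ₀⁻¹) • f) - (B f x * θ₀⁻¹) • e + (B e x * θ₀⁻¹) • f := by abel
    _ = (-(B f x * θ₀⁻¹)) • e + (B e x * θ₀⁻¹) • f := by rw [h0, zero_sub, neg_smul]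

/-! ### Dilations `D(α)`: `e ↦ α e`, `f ↦ (σα)⁻¹ f`, identity on `{e, f}^⊥` -/

/-- `D(α) y = y + ((1 − α) θ₀⁻¹ B f y) • e + (((σα)⁻¹ − 1) θ₀⁻¹ B e y) • f`. [folklore] -/
private theorem dil_apply (B : V →ₛₗ[σ] V →ₗ[K] K) (e f : V) (θ₀ α : K) (y : V) :
    ((1 : Module.End K V) + ((1 - α) * θ₀⁻¹) • (B f).smulRight e + (((σ α)⁻¹ - 1) * θ₀⁻¹) • (B e).smulRight f) y
      = y + ((1 - α) * θ₀⁻¹ * B f y) • e + (((σ α)⁻¹ - 1) * θ₀⁻¹ * B e y) • f := by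
  simp only [LinearMap.add_apply, Module.End.one_apply, LinearMap.smul_apply, LinearMap.smulRight_apply,
    smul_smul]

/-- `D(α) e = α • e`. [folklore] -/
private theorem dil_apply_e (B : V →ₛₗ[σ] V →ₗ[K] K) (hB : ∀ x y, σ (B x y) = B y x) {e f : V} {θ₀ : K}
    (he : B e e = 0) (hef : B e f = θ₀) (hθ : σ θ₀ = -θ₀) (hθ0 : θ₀ ≠ 0) (α : K) :
    ((1 : Module.End K V) + ((1 - α) * θ₀⁻¹) • (B f).smulRight e + (((σ α)⁻¹ - 1) * θ₀⁻¹) • (B e).smulRight f) e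
      = α • e := by
  rw [dil_apply, he, apply_fe B hB hef hθ, mul_zero, zero_smul, add_zero, mul_neg, inv_mul_cancel_right₀ hθ0]
  nth_rw 1 [← one_smul K e]
  rw [← add_smul]
  congr 1
  ring

/-- `D(α) f = (σα)⁻¹ • f`. [folklore] -/
private theorem dil_apply_f (B : V →ₛₗ[σ] V →ₗ[K] K) {e f : V} {θ₀ : K} (hf : B f f = 0) (hef : B e f = θ₀)
    (hθ0 : θ₀ ≠ 0) (α : K) :
    ((1 : Module.End K V) + ((1 - α) * θ₀⁻¹) • (B f).smulRight e + (((σ α)⁻¹ - 1) * θ₀⁻¹) • (B e).smulRight f) f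
      = (σ α)⁻¹ • f := by
  rw [dil_apply, hf, hef, mul_zero, zero_smul, add_zero, inv_mul_cancel_right₀ hθ0]
  nth_rw 1 [← one_smul K f]
  rw [← add_smul, add_sub_cancel]

/-- `D(α) w = w` for `w ⊥ e, f`. [folklore] -/
private theorem dil_apply_of_orth (B : V →ₛₗ[σ] V →ₗ[K] K) (e f : V) (θ₀ α : K) {w : V} (hw1 : B e w = 0)
    (hw2 : B f w = 0) :
    ((1 : Module.End K V) + ((1 - α) * θ₀⁻¹) • (B f).smulRight e + (((σ α)⁻¹ - 1) * θ₀⁻¹) • (B e).smulRight f) w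
      = w := by
  rw [dil_apply, hw1, hw2, mul_zero, mul_zero, zero_smul, zero_smul, add_zero, add_zero]

/-- **Dilations are isometries** (`σ` an involution, `α ≠ 0`). [cite: Dieudonne1971GroupesClassiques, Chap. II §5] -/
theorem dil_isometry (B : V →ₛₗ[σ] V →ₗ[K] K) (hB : ∀ x y, σ (B x y) = B y x) (hσ : ∀ x, σ (σ x) = x)
    {e f : V} {θ₀ : K} (he : B e e = 0) (hf : B f f = 0) (hef : B e f = θ₀) (hθ : σ θ₀ = -θ₀) (hθ0 : θ₀ ≠ 0)
    (α : K) (hα : α ≠ 0) (x y : V) :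
    B (((1 : Module.End K V) + ((1 - α) * θ₀⁻¹) • (B f).smulRight e +
          (((σ α)⁻¹ - 1) * θ₀⁻¹) • (B e).smulRight f) x)
      (((1 : Module.End K V) + ((1 - α) * θ₀⁻¹) • (B f).smulRight e +
          (((σ α)⁻¹ - 1) * θ₀⁻¹) • (B e).smulRight f) y) = B x y := by
  have hfe := apply_fe B hB hef hθ
  have hxe : B x e = σ (B e x) := (hB e x).symm
  have hxf : B x f = σ (B f x) := (hB f x).symm
  have hσα : σ α ≠ 0 := fun h => hα (by simpa [hσ] using congrArg σ h)
  rw [dil_apply, dil_apply]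
  simp only [map_add, LinearMap.map_smulₛₗ, map_smul, LinearMap.add_apply, LinearMap.smul_apply, smul_eq_mul,
    map_mul, map_sub, map_one, map_inv₀, hσ, hθ, he, hf, hef, hfe, hxe, hxf]
  field_simp
  ring

section DilDet

variable [FiniteDimensional K V]

/-- **`det D(α) = α (σα)⁻¹`**. [cite: Dieudonne1971GroupesClassiques, Chap. II §5] -/
theorem det_dil (B : V →ₛₗ[σ] V →ₗ[K] K) (hB : ∀ x y, σ (B x y) = B y x) {e f : V} {θ₀ : K}
    (hf : B f f = 0) (hef : B e f = θ₀) (hθ : σ θ₀ = -θ₀) (hθ0 : θ₀ ≠ 0) (α : K) :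
    LinearMap.det ((1 : Module.End K V) + ((1 - α) * θ₀⁻¹) • (B f).smulRight e +
        (((σ α)⁻¹ - 1) * θ₀⁻¹) • (B e).smulRight f) = α * (σ α)⁻¹ := by
  have hfe : B f e = -θ₀ := apply_fe B hB hef hθ
  have hmul : ((1 : Module.End K V) + ((1 - α) * θ₀⁻¹) • (B f).smulRight e +
        (((σ α)⁻¹ - 1) * θ₀⁻¹) • (B e).smulRight f) =
      ((1 : Module.End K V) + ((1 - α) * θ₀⁻¹) • (B f).smulRight e) *
        ((1 : Module.End K V) + (((σ α)⁻¹ - 1) * θ₀⁻¹) • (B e).smulRight f) := by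
    ext y
    simp only [Module.End.mul_apply, LinearMap.add_apply, Module.End.one_apply, LinearMap.smul_apply,
      LinearMap.smulRight_apply, map_add, map_smul, hf, smul_zero, zero_smul, add_zero]
  rw [hmul, map_mul, det_one_add_smul_smulRight, det_one_add_smul_smulRight, hfe, hef]
  field_simp
  ring

end DilDet

/-- `D(α) D(β) = D(α β)`. [folklore] -/
private theorem dil_mul_dil (B : V →ₛₗ[σ] V →ₗ[K] K) (hB : ∀ x y, σ (B x y) = B y x)
    {e f : V} {θ₀ : K} (he : B e e = 0) (hf : B f f = 0) (hef : B e f = θ₀) (hθ : σ θ₀ = -θ₀) (hθ0 : θ₀ ≠ 0)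
    (α β : K) :
    ((1 : Module.End K V) + ((1 - α) * θ₀⁻¹) • (B f).smulRight e + (((σ α)⁻¹ - 1) * θ₀⁻¹) • (B e).smulRight f) *
        ((1 : Module.End K V) + ((1 - β) * θ₀⁻¹) • (B f).smulRight e +
          (((σ β)⁻¹ - 1) * θ₀⁻¹) • (B e).smulRight f) =
      (1 : Module.End K V) + ((1 - α * β) * θ₀⁻¹) • (B f).smulRight e +
        (((σ (α * β))⁻¹ - 1) * θ₀⁻¹) • (B e).smulRight f := by
  refine ext_of_pair B hB he hf hef hθ hθ0 _ _ ?_ ?_ ?_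
  · rw [Module.End.mul_apply, dil_apply_e B hB he hef hθ hθ0, map_smul, dil_apply_e B hB he hef hθ hθ0,
      dil_apply_e B hB he hef hθ hθ0, smul_smul, mul_comm]
  · rw [Module.End.mul_apply, dil_apply_f B hf hef hθ0, map_smul, dil_apply_f B hf hef hθ0, dil_apply_f B hf hef hθ0,
      smul_smul, map_mul, mul_inv, mul_comm]
  · intro w hw1 hw2
    rw [Module.End.mul_apply, dil_apply_of_orth B e f θ₀ β hw1 hw2, dil_apply_of_orth B e f θ₀ α hw1 hw2,
      dil_apply_of_orth B e f θ₀ _ hw1 hw2]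

/-- `D(1) = 1`. [folklore] -/
private theorem dil_one (B : V →ₛₗ[σ] V →ₗ[K] K) (e f : V) (θ₀ : K) :
    ((1 : Module.End K V) + ((1 - (1 : K)) * θ₀⁻¹) • (B f).smulRight e +
      (((σ 1)⁻¹ - 1) * θ₀⁻¹) • (B e).smulRight f) = 1 := by
  rw [map_one, inv_one, sub_self, zero_mul, zero_smul, zero_smul, add_zero, add_zero]

/-! ## §6 Isometries: inverses, products, and multiplicative functions on them -/

/-- Products of isometries are isometries. [folklore] -/
private theorem isometry_mul (B : V →ₛₗ[σ] V →ₗ[K] K) (g h : Module.End K V) (hg : ∀ x y, B (g x) (g y) = B x y)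
    (hh : ∀ x y, B (h x) (h y) = B x y) (x y : V) : B ((g * h) x) ((g * h) y) = B x y := by
  rw [Module.End.mul_apply, Module.End.mul_apply, hg, hh]

/-- `1` is an isometry. [folklore] -/
private theorem isometry_one (B : V →ₛₗ[σ] V →ₗ[K] K) (x y : V) : B ((1 : Module.End K V) x) ((1 : Module.End K V) y) = B x y := by
  rw [Module.End.one_apply, Module.End.one_apply]

section Chi

variable {A : Type*} [CommGroup A] (B : V →ₛₗ[σ] V →ₗ[K] K) (χ : Module.End K V → A)
  (hχ : ∀ g h : Module.End K V, (∀ x y, B (g x) (g y) = B x y) → (∀ x y, B (h x) (h y) = B x y) →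
    χ (g * h) = χ g * χ h)
include hχ

/-- `χ 1 = 1`. [folklore] -/
private theorem chi_one : χ 1 = 1 := by
  have h := hχ 1 1 (isometry_one B) (isometry_one B)
  rw [mul_one] at h
  exact left_eq_mul.1 h

/-- `χ g * χ g' = 1` for an isometry `g` with isometric `g'`, `g g' = 1`. [folklore] -/
private theorem chi_mul_inv (g g' : Module.End K V) (hg : ∀ x y, B (g x) (g y) = B x y)
    (hg' : ∀ x y, B (g' x) (g' y) = B x y) (hgg' : g * g' = 1) : χ g * χ g' = 1 := by
  rw [← hχ g g' hg hg', hgg', chi_one B χ hχ]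

/-- **Conjugation invariance**: `χ (g t g') = χ t`. [folklore] -/
private theorem chi_conj (g t g' : Module.End K V) (hg : ∀ x y, B (g x) (g y) = B x y)
    (ht : ∀ x y, B (t x) (t y) = B x y) (hg' : ∀ x y, B (g' x) (g' y) = B x y) (hgg' : g * g' = 1) :
    χ (g * t * g') = χ t := by
  rw [hχ _ _ (isometry_mul B g t hg ht) hg', hχ _ _ hg ht, mul_right_comm, chi_mul_inv B χ hχ g g' hg hg' hgg',
    one_mul]

/-- `χ` of a product of three isometries. [folklore] -/
private theorem chi_mul_three (g h k : Module.End K V) (hg : ∀ x y, B (g x) (g y) = B x y)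
    (hh : ∀ x y, B (h x) (h y) = B x y) (hk : ∀ x y, B (k x) (k y) = B x y) :
    χ (g * h * k) = χ g * χ h * χ k := by
  rw [hχ _ _ (isometry_mul B g h hg hh) hk, hχ _ _ hg hh]

/-- `χ` of a product of four isometries. [folklore] -/
private theorem chi_mul_four (g h k l : Module.End K V) (hg : ∀ x y, B (g x) (g y) = B x y)
    (hh : ∀ x y, B (h x) (h y) = B x y) (hk : ∀ x y, B (k x) (k y) = B x y)
    (hl : ∀ x y, B (l x) (l y) = B x y) :
    χ (g * h * k * l) = χ g * χ h * χ k * χ l := by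
  rw [hχ _ _ (isometry_mul B _ k (isometry_mul B g h hg hh) hk) hl, chi_mul_three B χ hχ g h k hg hh hk]

/-! ### Killing transvections and root elements -/

omit hχ in
/-- `T(u, 0, z)` is an isometry for `B u u = 0` and skew `z`. [folklore] -/
private theorem transv_isometry (hB : ∀ x y, σ (B x y) = B y x) (u : V) (hu : B u u = 0) (z : K) (hz : z + σ z = 0)
    (x y : V) :
    B (((1 : Module.End K V) + (B u).smulRight (0 : V) + (z • B u - B (0 : V)).smulRight u) x)
      (((1 : Module.End K V) + (B u).smulRight (0 : V) + (z • B u - B (0 : V)).smulRight u) y) = B x y :=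
  root_isometry B hB u 0 z hu (map_zero _) (by simp only [map_zero, add_zero]; exact hz) x y

omit hχ in
/-- `T(u, 0, z) T(u, 0, z') = T(u, 0, z + z')`. [folklore] -/
private theorem transv_mul_transv (u : V) (hu : B u u = 0) (z z' : K) :
    ((1 : Module.End K V) + (B u).smulRight (0 : V) + (z • B u - B (0 : V)).smulRight u) *
        ((1 : Module.End K V) + (B u).smulRight (0 : V) + (z' • B u - B (0 : V)).smulRight u) =
      (1 : Module.End K V) + (B u).smulRight (0 : V) + ((z + z') • B u - B (0 : V)).smulRight u := by
  ext y
  simp only [Module.End.mul_apply, transv_apply, map_add, map_smul, hu, mul_zero]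
  module

omit hχ in
/-- `T(β u, 0, z) = T(u, 0, (σβ β) z)`. [folklore] -/
private theorem transv_smul_eq (u : V) (z β : K) :
    ((1 : Module.End K V) + (B (β • u)).smulRight (0 : V) + (z • B (β • u) - B (0 : V)).smulRight (β • u)) =
      (1 : Module.End K V) + (B u).smulRight (0 : V) + (((σ β * β) * z) • B u - B (0 : V)).smulRight u := by
  ext y
  rw [transv_apply, transv_apply]
  simp only [LinearMap.map_smulₛₗ, LinearMap.smul_apply, smul_eq_mul, smul_smul]
  ring_nf

omit hχ in
/-- `g T(u, 0, z) g' = T(g u, 0, z)` for an isometry `g` with `g g' = 1`. [folklore] -/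
private theorem conj_transv (g g' : Module.End K V) (hg : ∀ x y, B (g x) (g y) = B x y) (hgg' : g * g' = 1) (u : V)
    (z : K) :
    g * ((1 : Module.End K V) + (B u).smulRight (0 : V) + (z • B u - B (0 : V)).smulRight u) * g' =
      (1 : Module.End K V) + (B (g u)).smulRight (0 : V) + (z • B (g u) - B (0 : V)).smulRight (g u) := by
  ext y
  have hy : g (g' y) = y := by rw [← Module.End.mul_apply, hgg', Module.End.one_apply]
  rw [Module.End.mul_apply, Module.End.mul_apply, transv_apply, transv_apply, map_add, map_smul, hy]
  have h1 : B u (g' y) = B (g u) y := by conv_rhs => rw [← hy]; rw [hg]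
  rw [h1]

omit hχ in
/-- `T(−u, w, z) = T(u, −w, z)`. [folklore] -/
private theorem root_neg_eq (u w : V) (z : K) :
    ((1 : Module.End K V) + (B (-u)).smulRight w + (z • B (-u) - B w).smulRight (-u)) =
      (1 : Module.End K V) + (B u).smulRight (-w) + (z • B u - B (-w)).smulRight u := by
  ext y
  rw [root_apply, root_apply]
  simp only [map_neg, LinearMap.neg_apply, smul_neg, neg_smul, mul_neg, sub_neg_eq_add]
  module

/-- **Transvections are killed**: if some isometry rescales the isotropic `u` by `β` with `σβ·β ≠ 1`, then
`χ (T(u, 0, ζ)) = 1` for every `ζ` with `ζ + σ ζ = 0`. [cite: Dieudonne1971GroupesClassiques, Chap. II §5] -/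
theorem chi_transv (hB : ∀ x y, σ (B x y) = B y x) (hσ : ∀ x, σ (σ x) = x) (u : V) (hu : B u u = 0)
    (β : K) (hβ : σ β * β ≠ 1) (g g' : Module.End K V) (hg : ∀ x y, B (g x) (g y) = B x y)
    (hg' : ∀ x y, B (g' x) (g' y) = B x y) (hgg' : g * g' = 1) (hgu : g u = β • u)
    (ζ : K) (hζ : ζ + σ ζ = 0) :
    χ ((1 : Module.End K V) + (B u).smulRight (0 : V) + (ζ • B u - B (0 : V)).smulRight u) = 1 := by
  have hiso := transv_isometry B hB u hu
  have hN : σ (σ β * β) = σ β * β := by rw [map_mul, hσ, mul_comm]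
  -- step 1: `χ T(u, 0, N z) = χ T(u, 0, z)` for skew `z`
  have step1 : ∀ z : K, z + σ z = 0 →
      χ ((1 : Module.End K V) + (B u).smulRight (0 : V) + (((σ β * β) * z) • B u - B (0 : V)).smulRight u) =
        χ ((1 : Module.End K V) + (B u).smulRight (0 : V) + (z • B u - B (0 : V)).smulRight u) := by
    intro z hz
    have hc := conj_transv B g g' hg hgg' u z
    rw [hgu, transv_smul_eq B u z β] at hc
    rw [← hc, chi_conj B χ hχ g _ g' hg (hiso z hz) hg' hgg']
  -- step 2: `χ T(u, 0, (N − 1) z) = 1` for skew `z`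
  have step2 : ∀ z : K, z + σ z = 0 →
      χ ((1 : Module.End K V) + (B u).smulRight (0 : V) + (((σ β * β - 1) * z) • B u - B (0 : V)).smulRight u)
        = 1 := by
    intro z hz
    have hzN : (σ β * β) * z + σ ((σ β * β) * z) = 0 := by
      rw [map_mul, hN, ← mul_add, hz, mul_zero]
    have hzn : -z + σ (-z) = 0 := by rw [map_neg, ← neg_add, hz, neg_zero]
    have e1 : (σ β * β - 1) * z = σ β * β * z + -z := by ring
    rw [e1, ← transv_mul_transv B u hu, hχ _ _ (hiso _ hzN) (hiso _ hzn), step1 z hz,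
      ← hχ _ _ (hiso _ hz) (hiso _ hzn), transv_mul_transv B u hu, add_neg_cancel, root_zero, chi_one B χ hχ]
  -- step 3: every skew `ζ` is `(N − 1) z` with `z` skew
  have hN1 : σ β * β - 1 ≠ 0 := sub_ne_zero.2 hβ
  have e2 : ζ = (σ β * β - 1) * (ζ * (σ β * β - 1)⁻¹) := by field_simp
  rw [e2]
  refine step2 _ ?_
  rw [map_mul, map_inv₀, map_sub, hN, map_one, ← add_mul, hζ, zero_mul]

/-- **Root elements are killed**: with a rescaling isometry as in `chi_transv` and an isometry negating `u` and
fixing `w`, `χ (T(u, w, z)) = 1` for every admissible `(w, z)` (`2 ≠ 0`).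
[cite: Dieudonne1971GroupesClassiques, Chap. II §5] -/
theorem chi_root (hB : ∀ x y, σ (B x y) = B y x) (hσ : ∀ x, σ (σ x) = x) (h2 : (2 : K) ≠ 0) (u : V)
    (hu : B u u = 0) (β : K) (hβ : σ β * β ≠ 1) (g g' : Module.End K V) (hg : ∀ x y, B (g x) (g y) = B x y)
    (hg' : ∀ x y, B (g' x) (g' y) = B x y) (hgg' : g * g' = 1) (hgu : g u = β • u)
    (n n' : Module.End K V) (hn : ∀ x y, B (n x) (n y) = B x y) (hn' : ∀ x y, B (n' x) (n' y) = B x y)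
    (hnn' : n * n' = 1) (hnu : n u = -u) (w : V) (huw : B u w = 0) (hnw : n w = w) (z : K)
    (hz : z + σ z + B w w = 0) :
    χ ((1 : Module.End K V) + (B u).smulRight w + (z • B u - B w).smulRight u) = 1 := by
  have h2σ : σ 2 = 2 := map_ofNat σ 2
  have h22 : (2 : K)⁻¹ * 2 = 1 := inv_mul_cancel₀ h2
  have hww : σ (B w w) = B w w := hB w w
  have hiso : ∀ (w' : V) (z' : K), B u w' = 0 → z' + σ z' + B w' w' = 0 → ∀ x y,
      B (((1 : Module.End K V) + (B u).smulRight w' + (z' • B u - B w').smulRight u) x)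
        (((1 : Module.End K V) + (B u).smulRight w' + (z' • B u - B w').smulRight u) y) = B x y :=
    fun w' z' h1 h3 => root_isometry B hB u w' z' hu h1 h3
  -- (i) negating `u`: `χ T(u, −w', z') = χ T(u, w', z')`
  have neg_eq : ∀ (w' : V) (z' : K), B u w' = 0 → n w' = w' → z' + σ z' + B w' w' = 0 →
      χ ((1 : Module.End K V) + (B u).smulRight (-w') + (z' • B u - B (-w')).smulRight u) =
        χ ((1 : Module.End K V) + (B u).smulRight w' + (z' • B u - B w').smulRight u) := by
    intro w' z' h1 hnw' h3
    have hc := conj_root B n n' hn hnn' u w' z'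
    rw [hnw', hnu, root_neg_eq B u w' z'] at hc
    rw [← hc, chi_conj B χ hχ n _ n' hn (hiso w' z' h1 h3) hn' hnn']
  -- (ii) the square of the canonical root element on `w'` is killed
  have sq_eq : ∀ w' : V, B u w' = 0 → n w' = w' →
      χ (((1 : Module.End K V) + (B u).smulRight w' + ((-(B w' w') * 2⁻¹) • B u - B w').smulRight u) *
        ((1 : Module.End K V) + (B u).smulRight w' + ((-(B w' w') * 2⁻¹) • B u - B w').smulRight u)) = 1 := by
    intro w' h1 hnw'
    have hfix : σ (-(B w' w') * 2⁻¹) = -(B w' w') * 2⁻¹ := by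
      rw [map_mul, map_neg, map_inv₀, h2σ, hB w' w']
    have hadm : -(B w' w') * 2⁻¹ + σ (-(B w' w') * 2⁻¹) + B w' w' = 0 := by
      rw [hfix]; linear_combination (-(B w' w')) * h22
    have hadm' : -(B w' w') * 2⁻¹ + σ (-(B w' w') * 2⁻¹) + B (-w') (-w') = 0 := by
      simp only [map_neg, LinearMap.neg_apply, neg_neg]; exact hadm
    have hn2 := neg_eq w' (-(B w' w') * 2⁻¹) h1 hnw' hadm
    have hinv := root_mul_root_neg B hB u w' (-(B w' w') * 2⁻¹) hu h1 hadm
    rw [hfix] at hinv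
    rw [hχ _ _ (hiso w' _ h1 hadm) (hiso w' _ h1 hadm)]
    nth_rw 2 [← hn2]
    rw [← hχ _ _ (hiso w' _ h1 hadm) (hiso (-w') _ (by rw [map_neg, h1, neg_zero]) hadm'), hinv,
      chi_one B χ hχ]
  -- (iii) the canonical root element on `w` is killed (apply (ii) to `w/2`)
  have hcan : χ ((1 : Module.End K V) + (B u).smulRight w +
      ((-(B w w) * 2⁻¹) • B u - B w).smulRight u) = 1 := by
    have h1 : B u ((2⁻¹ : K) • w) = 0 := by rw [map_smul, huw, smul_zero]
    have h := sq_eq ((2⁻¹ : K) • w) h1 (by rw [map_smul, hnw])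
    rw [root_mul_root B hB u _ _ _ _ hu h1 h1] at h
    have e1 : (2⁻¹ : K) • w + (2⁻¹ : K) • w = w := by
      rw [← add_smul, ← mul_two, h22, one_smul]
    have e2 : -(B ((2⁻¹ : K) • w) ((2⁻¹ : K) • w)) * 2⁻¹ + -(B ((2⁻¹ : K) • w) ((2⁻¹ : K) • w)) * 2⁻¹ -
        B ((2⁻¹ : K) • w) ((2⁻¹ : K) • w) = -(B w w) * 2⁻¹ := by
      rw [apply_smul_left, apply_smul_right, map_inv₀, h2σ]
      linear_combination (-(2⁻¹ : K) * B w w * (2⁻¹ + 1)) * h22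
    rwa [e1, e2] at h
  -- (iv) split off a transvection
  have hζs : (z + B w w * 2⁻¹) + σ (z + B w w * 2⁻¹) = 0 := by
    rw [map_add, map_mul, map_inv₀, h2σ, hww]
    linear_combination hz + (B w w) * h22
  have hsplit : ((1 : Module.End K V) + (B u).smulRight w + ((-(B w w) * 2⁻¹) • B u - B w).smulRight u) *
      ((1 : Module.End K V) + (B u).smulRight (0 : V) + ((z + B w w * 2⁻¹) • B u - B (0 : V)).smulRight u) =
      (1 : Module.End K V) + (B u).smulRight w + (z • B u - B w).smulRight u := by
    have hwu : B w u = 0 := apply_eq_zero_comm B hB huw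
    ext y
    rw [Module.End.mul_apply, transv_apply, root_apply, root_apply]
    simp only [map_add, map_smul, smul_eq_mul, hu, hwu, mul_zero, add_zero]
    module
  rw [← hsplit, hχ _ _ (hiso w _ huw (by rw [map_mul, map_neg, map_inv₀, h2σ, hww]; linear_combination (-(B w w)) * h22))
    (transv_isometry B hB u hu _ hζs), hcan, one_mul]
  exact chi_transv B χ hχ hB hσ u hu β hβ g g' hg hg' hgg' hgu _ hζs

end Chi

/-! ## §7 The hyperbolic plane: transvections on `e` and `f`, the `SL₂(K^σ)` identity, elements fixing `{e,f}^⊥` -/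

/-- There is `β ≠ 0` with `σβ·β ≠ 1` (one of `θ₀`, `1 + θ₀`; uses `2 ≠ 0`). [folklore] -/
private theorem exists_norm_ne_one (hσ1 : σ 1 = 1) {θ₀ : K} (hθ : σ θ₀ = -θ₀) (hθ0 : θ₀ ≠ 0) (h2 : (2 : K) ≠ 0) :
    ∃ β : K, β ≠ 0 ∧ σ β * β ≠ 1 := by
  by_cases h : σ θ₀ * θ₀ = 1
  · refine ⟨1 + θ₀, fun h0 => ?_, fun h1 => ?_⟩
    · have : θ₀ = -1 := by linear_combination h0
      rw [this, map_neg, hσ1, neg_neg] at hθ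
      exact h2 (by linear_combination -hθ)
    · rw [map_add, hσ1, hθ] at h1
      have : θ₀ * θ₀ = 0 := by linear_combination -h1
      exact hθ0 (mul_self_eq_zero.1 this)
  · exact ⟨θ₀, hθ0, h⟩

/-- `B (a e + b f) (a e + b f) = 0 ⇒ σ a · b = σ b · a`. [folklore] -/
private theorem coeff_rel_of_isotropic (B : V →ₛₗ[σ] V →ₗ[K] K) (hB : ∀ x y, σ (B x y) = B y x) {e f : V} {θ₀ : K}
    (he : B e e = 0) (hf : B f f = 0) (hef : B e f = θ₀) (hθ : σ θ₀ = -θ₀) (hθ0 : θ₀ ≠ 0) (a b : K)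
    (h : B (a • e + b • f) (a • e + b • f) = 0) : σ a * b = σ b * a := by
  have hfe := apply_fe B hB hef hθ
  simp only [map_add, LinearMap.map_smulₛₗ, map_smul, LinearMap.add_apply, LinearMap.smul_apply, smul_eq_mul, he,
    hf, hef, hfe] at h
  have : θ₀ * (σ a * b - σ b * a) = 0 := by linear_combination h
  exact sub_eq_zero.1 ((mul_eq_zero.1 this).resolve_left hθ0)

/-- `B (p e + r f) (q e + s f) = θ₀ ⇒ σ p · s − σ r · q = 1`. [folklore] -/
private theorem coeff_rel_of_pair (B : V →ₛₗ[σ] V →ₗ[K] K) (hB : ∀ x y, σ (B x y) = B y x) {e f : V} {θ₀ : K}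
    (he : B e e = 0) (hf : B f f = 0) (hef : B e f = θ₀) (hθ : σ θ₀ = -θ₀) (hθ0 : θ₀ ≠ 0) (p r q s : K)
    (h : B (p • e + r • f) (q • e + s • f) = θ₀) : σ p * s - σ r * q = 1 := by
  have hfe := apply_fe B hB hef hθ
  simp only [map_add, LinearMap.map_smulₛₗ, map_smul, LinearMap.add_apply, LinearMap.smul_apply, smul_eq_mul, he,
    hf, hef, hfe] at h
  have : θ₀ * (σ p * s - σ r * q - 1) = 0 := by linear_combination h
  exact sub_eq_zero.1 ((mul_eq_zero.1 this).resolve_left hθ0)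

/-- `T(e, 0, ζ) (a e + b f) = (a + ζ θ₀ b) e + b f`. [folklore] -/
private theorem transv_e_apply_pair (B : V →ₛₗ[σ] V →ₗ[K] K) {e f : V} {θ₀ : K} (he : B e e = 0) (hef : B e f = θ₀)
    (ζ a b : K) :
    ((1 : Module.End K V) + (B e).smulRight (0 : V) + (ζ • B e - B (0 : V)).smulRight e) (a • e + b • f) =
      (a + ζ * θ₀ * b) • e + b • f := by
  rw [transv_apply, map_add, map_smul, map_smul, he, hef, smul_zero, zero_add, smul_eq_mul]
  module

/-- `T(f, 0, ζ) (a e + b f) = a e + (b − ζ θ₀ a) f`. [folklore] -/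
private theorem transv_f_apply_pair (B : V →ₛₗ[σ] V →ₗ[K] K) (hB : ∀ x y, σ (B x y) = B y x) {e f : V} {θ₀ : K}
    (hf : B f f = 0) (hef : B e f = θ₀) (hθ : σ θ₀ = -θ₀) (ζ a b : K) :
    ((1 : Module.End K V) + (B f).smulRight (0 : V) + (ζ • B f - B (0 : V)).smulRight f) (a • e + b • f) =
      a • e + (b - ζ * θ₀ * a) • f := by
  rw [transv_apply, map_add, map_smul, map_smul, hf, apply_fe B hB hef hθ, smul_zero, add_zero, smul_eq_mul]
  module

/-- `D(α) (a e + b f) = (α a) e + ((σα)⁻¹ b) f`. [folklore] -/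
private theorem dil_apply_pair (B : V →ₛₗ[σ] V →ₗ[K] K) (hB : ∀ x y, σ (B x y) = B y x) {e f : V} {θ₀ : K}
    (he : B e e = 0) (hf : B f f = 0) (hef : B e f = θ₀) (hθ : σ θ₀ = -θ₀) (hθ0 : θ₀ ≠ 0) (α a b : K) :
    ((1 : Module.End K V) + ((1 - α) * θ₀⁻¹) • (B f).smulRight e + (((σ α)⁻¹ - 1) * θ₀⁻¹) • (B e).smulRight f)
        (a • e + b • f) = (α * a) • e + ((σ α)⁻¹ * b) • f := by
  rw [map_add, map_smul, map_smul, dil_apply_e B hB he hef hθ hθ0, dil_apply_f B hf hef hθ0, smul_smul, smul_smul,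
    mul_comm a, mul_comm b]

section PlaneChi

variable {A : Type*} [CommGroup A] (B : V →ₛₗ[σ] V →ₗ[K] K) (χ : Module.End K V → A)
  (hχ : ∀ g h : Module.End K V, (∀ x y, B (g x) (g y) = B x y) → (∀ x y, B (h x) (h y) = B x y) →
    χ (g * h) = χ g * χ h)
  (hB : ∀ x y, σ (B x y) = B y x) (hσ : ∀ x, σ (σ x) = x) (h2 : (2 : K) ≠ 0)
  {e f : V} {θ₀ : K} (he : B e e = 0) (hf : B f f = 0) (hef : B e f = θ₀) (hθ : σ θ₀ = -θ₀) (hθ0 : θ₀ ≠ 0)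
include hχ hB hσ h2 he hf hef hθ hθ0

/-- **Root elements on `e` are killed**: `χ (T(e, w, z)) = 1` for `w ⊥ e, f` and admissible `z`.
[cite: Dieudonne1971GroupesClassiques, Chap. II §5] -/
theorem chi_root_e (w : V) (hw1 : B e w = 0) (hw2 : B f w = 0) (z : K) (hz : z + σ z + B w w = 0) :
    χ ((1 : Module.End K V) + (B e).smulRight w + (z • B e - B w).smulRight e) = 1 := by
  have hσ1 : σ 1 = 1 := map_one σ
  obtain ⟨β, hβ0, hβ⟩ := exists_norm_ne_one hσ1 hθ hθ0 h2
  have hDiso : ∀ α : K, α ≠ 0 → ∀ x y, B (((1 : Module.End K V) + ((1 - α) * θ₀⁻¹) • (B f).smulRight e +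
      (((σ α)⁻¹ - 1) * θ₀⁻¹) • (B e).smulRight f) x) (((1 : Module.End K V) + ((1 - α) * θ₀⁻¹) • (B f).smulRight e +
      (((σ α)⁻¹ - 1) * θ₀⁻¹) • (B e).smulRight f) y) = B x y :=
    fun α hα => dil_isometry B hB hσ he hf hef hθ hθ0 α hα
  have hDinv : ∀ α : K, α ≠ 0 → ((1 : Module.End K V) + ((1 - α) * θ₀⁻¹) • (B f).smulRight e +
      (((σ α)⁻¹ - 1) * θ₀⁻¹) • (B e).smulRight f) * ((1 : Module.End K V) + ((1 - α⁻¹) * θ₀⁻¹) • (B f).smulRight e +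
      (((σ α⁻¹)⁻¹ - 1) * θ₀⁻¹) • (B e).smulRight f) = 1 := by
    intro α hα
    rw [dil_mul_dil B hB he hf hef hθ hθ0, mul_inv_cancel₀ hα, dil_one]
  refine chi_root B χ hχ hB hσ h2 e he β hβ _ _ (hDiso β hβ0) (hDiso β⁻¹ (inv_ne_zero hβ0)) (hDinv β hβ0)
    (dil_apply_e B hB he hef hθ hθ0 β) _ _ (hDiso (-1) (neg_ne_zero.2 one_ne_zero))
    (hDiso (-1)⁻¹ (inv_ne_zero (neg_ne_zero.2 one_ne_zero))) (hDinv (-1) (neg_ne_zero.2 one_ne_zero)) ?_ w hw1 ?_ z hz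
  · rw [dil_apply_e B hB he hef hθ hθ0, neg_one_smul]
  · exact dil_apply_of_orth B e f θ₀ (-1) hw1 hw2

/-- **Root elements on `f` are killed**: `χ (T(f, w, z)) = 1` for `w ⊥ e, f` and admissible `z`.
[cite: Dieudonne1971GroupesClassiques, Chap. II §5] -/
theorem chi_root_f (w : V) (hw1 : B e w = 0) (hw2 : B f w = 0) (z : K) (hz : z + σ z + B w w = 0) :
    χ ((1 : Module.End K V) + (B f).smulRight w + (z • B f - B w).smulRight f) = 1 := by
  have hσ1 : σ 1 = 1 := map_one σ
  obtain ⟨β, hβ0, hβ⟩ := exists_norm_ne_one hσ1 hθ hθ0 h2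
  have hσβ : σ β ≠ 0 := fun h => hβ0 (by simpa [hσ] using congrArg σ h)
  have hDiso : ∀ α : K, α ≠ 0 → ∀ x y, B (((1 : Module.End K V) + ((1 - α) * θ₀⁻¹) • (B f).smulRight e +
      (((σ α)⁻¹ - 1) * θ₀⁻¹) • (B e).smulRight f) x) (((1 : Module.End K V) + ((1 - α) * θ₀⁻¹) • (B f).smulRight e +
      (((σ α)⁻¹ - 1) * θ₀⁻¹) • (B e).smulRight f) y) = B x y :=
    fun α hα => dil_isometry B hB hσ he hf hef hθ hθ0 α hα
  have hDinv : ∀ α : K, α ≠ 0 → ((1 : Module.End K V) + ((1 - α) * θ₀⁻¹) • (B f).smulRight e +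
      (((σ α)⁻¹ - 1) * θ₀⁻¹) • (B e).smulRight f) * ((1 : Module.End K V) + ((1 - α⁻¹) * θ₀⁻¹) • (B f).smulRight e +
      (((σ α⁻¹)⁻¹ - 1) * θ₀⁻¹) • (B e).smulRight f) = 1 := by
    intro α hα
    rw [dil_mul_dil B hB he hf hef hθ hθ0, mul_inv_cancel₀ hα, dil_one]
  have hN : σ (σ β)⁻¹ * (σ β)⁻¹ ≠ 1 := by
    rw [map_inv₀, hσ]
    intro h
    apply hβ
    have := congrArg (fun t => t * (σ β * β)) h
    simp only [one_mul] at this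
    rw [← this]
    field_simp
  refine chi_root B χ hχ hB hσ h2 f hf (σ β)⁻¹ hN _ _ (hDiso β hβ0) (hDiso β⁻¹ (inv_ne_zero hβ0)) (hDinv β hβ0)
    (dil_apply_f B hf hef hθ0 β) _ _ (hDiso (-1) (neg_ne_zero.2 one_ne_zero))
    (hDiso (-1)⁻¹ (inv_ne_zero (neg_ne_zero.2 one_ne_zero))) (hDinv (-1) (neg_ne_zero.2 one_ne_zero)) ?_ w hw2 ?_ z hz
  · rw [dil_apply_f B hf hef hθ0, map_neg, map_one, inv_neg, inv_one, neg_one_smul]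
  · exact dil_apply_of_orth B e f θ₀ (-1) hw1 hw2

/-- Transvections on `e` are killed: `χ (T(e, 0, ζ)) = 1` for skew `ζ`. [cite: Dieudonne1971GroupesClassiques, Chap. II §5] -/
theorem chi_transv_e (ζ : K) (hζ : ζ + σ ζ = 0) :
    χ ((1 : Module.End K V) + (B e).smulRight (0 : V) + (ζ • B e - B (0 : V)).smulRight e) = 1 :=
  chi_root_e B χ hχ hB hσ h2 he hf hef hθ hθ0 0 (map_zero _) (map_zero _) ζ
    (by simp only [map_zero, add_zero]; exact hζ)

/-- Transvections on `f` are killed: `χ (T(f, 0, ζ)) = 1` for skew `ζ`. [cite: Dieudonne1971GroupesClassiques, Chap. II §5] -/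
theorem chi_transv_f (ζ : K) (hζ : ζ + σ ζ = 0) :
    χ ((1 : Module.End K V) + (B f).smulRight (0 : V) + (ζ • B f - B (0 : V)).smulRight f) = 1 :=
  chi_root_f B χ hχ hB hσ h2 he hf hef hθ hθ0 0 (map_zero _) (map_zero _) ζ
    (by simp only [map_zero, add_zero]; exact hζ)

/-- **The `SL₂(K^σ)` identity**: for `σ α = α ≠ 0`, `χ (D(α)) = 1` — because
`D(α) · U(1) L(1) U(1) = U(α) L(α⁻¹) U(α)` with `U(t) = T(e, 0, t θ₀⁻¹)`, `L(t) = T(f, 0, t θ₀⁻¹)`, all killed.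
[cite: Dieudonne1971GroupesClassiques, Chap. II §5] -/
theorem chi_dil_of_fixed (α : K) (hα : σ α = α) (hα0 : α ≠ 0) :
    χ ((1 : Module.End K V) + ((1 - α) * θ₀⁻¹) • (B f).smulRight e +
      (((σ α)⁻¹ - 1) * θ₀⁻¹) • (B e).smulRight f) = 1 := by
  have hfe := apply_fe B hB hef hθ
  -- skewness of the parameters
  have hsk : ∀ t : K, σ t = t → t * θ₀⁻¹ + σ (t * θ₀⁻¹) = 0 := by
    intro t ht; rw [map_mul, map_inv₀, ht, hθ, inv_neg]; ring
  have hisoE : ∀ t : K, σ t = t → ∀ x y, B (((1 : Module.End K V) + (B e).smulRight (0 : V) +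
      ((t * θ₀⁻¹) • B e - B (0 : V)).smulRight e) x) (((1 : Module.End K V) + (B e).smulRight (0 : V) +
      ((t * θ₀⁻¹) • B e - B (0 : V)).smulRight e) y) = B x y :=
    fun t ht => transv_isometry B hB e he _ (hsk t ht)
  have hisoF : ∀ t : K, σ t = t → ∀ x y, B (((1 : Module.End K V) + (B f).smulRight (0 : V) +
      ((t * θ₀⁻¹) • B f - B (0 : V)).smulRight f) x) (((1 : Module.End K V) + (B f).smulRight (0 : V) +
      ((t * θ₀⁻¹) • B f - B (0 : V)).smulRight f) y) = B x y :=
    fun t ht => transv_isometry B hB f hf _ (hsk t ht)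
  have hDiso : ∀ x y, B (((1 : Module.End K V) + ((1 - α) * θ₀⁻¹) • (B f).smulRight e +
      (((σ α)⁻¹ - 1) * θ₀⁻¹) • (B e).smulRight f) x) (((1 : Module.End K V) + ((1 - α) * θ₀⁻¹) • (B f).smulRight e +
      (((σ α)⁻¹ - 1) * θ₀⁻¹) • (B e).smulRight f) y) = B x y := dil_isometry B hB hσ he hf hef hθ hθ0 α hα0
  have h1 : σ (1 : K) = 1 := map_one σ
  have hαi : σ α⁻¹ = α⁻¹ := by rw [map_inv₀, hα]
  -- the identity of endomorphisms
  have key : ((1 : Module.End K V) + ((1 - α) * θ₀⁻¹) • (B f).smulRight e +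
        (((σ α)⁻¹ - 1) * θ₀⁻¹) • (B e).smulRight f) *
      ((1 : Module.End K V) + (B e).smulRight (0 : V) + (((1 : K) * θ₀⁻¹) • B e - B (0 : V)).smulRight e) *
      ((1 : Module.End K V) + (B f).smulRight (0 : V) + (((1 : K) * θ₀⁻¹) • B f - B (0 : V)).smulRight f) *
      ((1 : Module.End K V) + (B e).smulRight (0 : V) + (((1 : K) * θ₀⁻¹) • B e - B (0 : V)).smulRight e) =
      ((1 : Module.End K V) + (B e).smulRight (0 : V) + ((α * θ₀⁻¹) • B e - B (0 : V)).smulRight e) *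
      ((1 : Module.End K V) + (B f).smulRight (0 : V) + ((α⁻¹ * θ₀⁻¹) • B f - B (0 : V)).smulRight f) *
      ((1 : Module.End K V) + (B e).smulRight (0 : V) + ((α * θ₀⁻¹) • B e - B (0 : V)).smulRight e) := by
    have tE : ∀ (t a b : K), ((1 : Module.End K V) + (B e).smulRight (0 : V) +
        ((t * θ₀⁻¹) • B e - B (0 : V)).smulRight e) (a • e + b • f) = (a + t * b) • e + b • f := by
      intro t a b; rw [transv_e_apply_pair B he hef, inv_mul_cancel_right₀ hθ0]
    have tF : ∀ (t a b : K), ((1 : Module.End K V) + (B f).smulRight (0 : V) +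
        ((t * θ₀⁻¹) • B f - B (0 : V)).smulRight f) (a • e + b • f) = a • e + (b - t * a) • f := by
      intro t a b; rw [transv_f_apply_pair B hB hf hef hθ, inv_mul_cancel_right₀ hθ0]
    have tD : ∀ a b : K, ((1 : Module.End K V) + ((1 - α) * θ₀⁻¹) • (B f).smulRight e +
        (((σ α)⁻¹ - 1) * θ₀⁻¹) • (B e).smulRight f) (a • e + b • f) = (α * a) • e + (α⁻¹ * b) • f := by
      intro a b; rw [dil_apply_pair B hB he hf hef hθ hθ0, hα]
    have hpair : ∀ a b : K,
        (((1 : Module.End K V) + ((1 - α) * θ₀⁻¹) • (B f).smulRight e +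
          (((σ α)⁻¹ - 1) * θ₀⁻¹) • (B e).smulRight f) *
        ((1 : Module.End K V) + (B e).smulRight (0 : V) + (((1 : K) * θ₀⁻¹) • B e - B (0 : V)).smulRight e) *
        ((1 : Module.End K V) + (B f).smulRight (0 : V) + (((1 : K) * θ₀⁻¹) • B f - B (0 : V)).smulRight f) *
        ((1 : Module.End K V) + (B e).smulRight (0 : V) + (((1 : K) * θ₀⁻¹) • B e - B (0 : V)).smulRight e))
          (a • e + b • f) =
        (((1 : Module.End K V) + (B e).smulRight (0 : V) + ((α * θ₀⁻¹) • B e - B (0 : V)).smulRight e) *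
        ((1 : Module.End K V) + (B f).smulRight (0 : V) + ((α⁻¹ * θ₀⁻¹) • B f - B (0 : V)).smulRight f) *
        ((1 : Module.End K V) + (B e).smulRight (0 : V) + ((α * θ₀⁻¹) • B e - B (0 : V)).smulRight e))
          (a • e + b • f) := by
      intro a b
      simp only [Module.End.mul_apply, tE, tF, tD]
      match_scalars <;> (try field_simp) <;> ring
    refine ext_of_pair B hB he hf hef hθ hθ0 _ _ ?_ ?_ ?_
    · have h10 := hpair 1 0
      rw [one_smul, zero_smul, add_zero] at h10
      exact h10
    · have h01 := hpair 0 1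
      rw [one_smul, zero_smul, zero_add] at h01
      exact h01
    · intro w hw1 hw2
      have hw0 : B (0 : V) w = 0 := by rw [map_zero, LinearMap.zero_apply]
      simp only [Module.End.mul_apply, root_apply_of_orth B e 0 _ hw1 hw0, root_apply_of_orth B f 0 _ hw2 hw0,
        dil_apply_of_orth B e f θ₀ α hw1 hw2]
  have hL := congrArg χ key
  rw [chi_mul_four B χ hχ _ _ _ _ hDiso (hisoE 1 h1) (hisoF 1 h1) (hisoE 1 h1),
    chi_mul_three B χ hχ _ _ _ (hisoE α hα) (hisoF α⁻¹ hαi) (hisoE α hα),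
    chi_transv_e B χ hχ hB hσ h2 he hf hef hθ hθ0 _ (hsk 1 h1), chi_transv_f B χ hχ hB hσ h2 he hf hef hθ hθ0 _ (hsk 1 h1),
    chi_transv_e B χ hχ hB hσ h2 he hf hef hθ hθ0 _ (hsk α hα),
    chi_transv_f B χ hχ hB hσ h2 he hf hef hθ hθ0 _ (hsk α⁻¹ hαi)] at hL
  simpa using hL

end PlaneChi

section PlaneFix

variable {A : Type*} [CommGroup A] (B : V →ₛₗ[σ] V →ₗ[K] K) (χ : Module.End K V → A)
  (hχ : ∀ g h : Module.End K V, (∀ x y, B (g x) (g y) = B x y) → (∀ x y, B (h x) (h y) = B x y) →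
    χ (g * h) = χ g * χ h)
  (hB : ∀ x y, σ (B x y) = B y x) (hσ : ∀ x, σ (σ x) = x) (hBnd : ∀ x, (∀ y, B x y = 0) → x = 0)
  (h2 : (2 : K) ≠ 0)
  {e f : V} {θ₀ : K} (he : B e e = 0) (hf : B f f = 0) (hef : B e f = θ₀) (hθ : σ θ₀ = -θ₀) (hθ0 : θ₀ ≠ 0)

include hB hBnd he hf hef hθ hθ0 in
/-- An isometry fixing `{e, f}^⊥` pointwise maps `e` and `f` into the span of `e, f`. [folklore] -/
private theorem fixW_apply_pair (k : Module.End K V) (hk : ∀ x y, B (k x) (k y) = B x y)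
    (hkW : ∀ w, B e w = 0 → B f w = 0 → k w = w) (v : V) (hv : v = e ∨ v = f) :
    k v = (-(B f (k v) * θ₀⁻¹)) • e + (B e (k v) * θ₀⁻¹) • f := by
  refine eq_pair_of_orth B hB hBnd he hf hef hθ hθ0 (k v) fun w hw1 hw2 => ?_
  conv_lhs => rw [← hkW w hw1 hw2]
  rw [hk]
  rcases hv with rfl | rfl
  · exact hw1
  · exact hw2

include hB hσ hBnd he hf hef hθ hθ0 in
/-- **Normal form, first case**: an isometry fixing `{e, f}^⊥` with `k e = p e` is `D(p) T(e, 0, ζ)` with `ζ` skew,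
and `p ≠ 0`. [cite: Dieudonne1971GroupesClassiques, Chap. II §5] -/
theorem fixW_eq_dil_mul_transv (k : Module.End K V) (hk : ∀ x y, B (k x) (k y) = B x y)
    (hkW : ∀ w, B e w = 0 → B f w = 0 → k w = w) (p : K) (hke : k e = p • e) :
    p ≠ 0 ∧ ∃ ζ : K, ζ + σ ζ = 0 ∧ k = ((1 : Module.End K V) + ((1 - p) * θ₀⁻¹) • (B f).smulRight e +
      (((σ p)⁻¹ - 1) * θ₀⁻¹) • (B e).smulRight f) *
      ((1 : Module.End K V) + (B e).smulRight (0 : V) + (ζ • B e - B (0 : V)).smulRight e) := by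
  obtain ⟨q, s, hkf⟩ : ∃ q s : K, k f = q • e + s • f :=
    ⟨_, _, fixW_apply_pair B hB hBnd he hf hef hθ hθ0 k hk hkW f (Or.inr rfl)⟩
  have hke' : k e = p • e + (0 : K) • f := by rw [hke, zero_smul, add_zero]
  have R3 := coeff_rel_of_pair B hB he hf hef hθ hθ0 p 0 q s (by rw [← hke', ← hkf, hk, hef])
  rw [map_zero, zero_mul, sub_zero] at R3
  have hp : p ≠ 0 := by
    rintro rfl
    rw [map_zero, zero_mul] at R3
    exact zero_ne_one R3
  have hσp : σ p ≠ 0 := fun h => hp (by simpa [hσ] using congrArg σ h)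
  have hs' : s = (σ p)⁻¹ := by rw [← mul_one (σ p)⁻¹, ← R3, inv_mul_cancel_left₀ hσp]
  have R2 := coeff_rel_of_isotropic B hB he hf hef hθ hθ0 q s (by rw [← hkf, hk, hf])
  rw [hs', map_inv₀, hσ] at R2
  have hσq : σ q = p⁻¹ * q * σ p := by rwa [mul_inv_eq_iff_eq_mul₀ hσp] at R2
  refine ⟨hp, q * (θ₀ * p)⁻¹, ?_, ?_⟩
  · rw [map_mul, map_inv₀, map_mul, hθ, hσq]
    field_simp
    ring
  · refine ext_of_pair B hB he hf hef hθ hθ0 _ _ ?_ ?_ ?_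
    · rw [Module.End.mul_apply, root_apply_self B hB e 0 _ he (map_zero _), dil_apply_e B hB he hef hθ hθ0, hke]
    · rw [Module.End.mul_apply, transv_apply, hef, map_add, map_smul, dil_apply_f B hf hef hθ0,
        dil_apply_e B hB he hef hθ hθ0, hkf, hs', smul_smul]
      match_scalars <;> field_simp
    · intro w hw1 hw2
      rw [hkW w hw1 hw2, Module.End.mul_apply,
        root_apply_of_orth B e 0 _ hw1 (by rw [map_zero, LinearMap.zero_apply]), dil_apply_of_orth B e f θ₀ p hw1 hw2]

include hχ hB hσ hBnd h2 he hf hef hθ hθ0 in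
/-- **Normal form**: an isometry `k` fixing `{e, f}^⊥` pointwise has `det k = p (σp)⁻¹` and `χ k = χ D(p)` for some
`p ≠ 0` (left-multiply by two transvections to reach `k e ∈ K e`). [cite: Dieudonne1971GroupesClassiques, Chap. II §5] -/
theorem exists_det_eq_and_chi_eq [FiniteDimensional K V] (k : Module.End K V) (hk : ∀ x y, B (k x) (k y) = B x y)
    (hkW : ∀ w, B e w = 0 → B f w = 0 → k w = w) :
    ∃ p : K, p ≠ 0 ∧ LinearMap.det k = p * (σ p)⁻¹ ∧
      χ k = χ ((1 : Module.End K V) + ((1 - p) * θ₀⁻¹) • (B f).smulRight e +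
        (((σ p)⁻¹ - 1) * θ₀⁻¹) • (B e).smulRight f) := by
  classical
  -- coordinates of `k e`, `k f`
  obtain ⟨p₀, r, hke⟩ : ∃ p₀ r : K, k e = p₀ • e + r • f :=
    ⟨_, _, fixW_apply_pair B hB hBnd he hf hef hθ hθ0 k hk hkW e (Or.inl rfl)⟩
  obtain ⟨q₀, s₀, hkf⟩ : ∃ q s : K, k f = q • e + s • f :=
    ⟨_, _, fixW_apply_pair B hB hBnd he hf hef hθ hθ0 k hk hkW f (Or.inr rfl)⟩
  -- first transvection (on `e`): make the `e`-coefficient non-zero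
  obtain ⟨ζ₂, hζ₂⟩ : ∃ ζ₂ : K, ζ₂ = if p₀ = 0 then θ₀⁻¹ else 0 := ⟨_, rfl⟩
  have hζ₂s : ζ₂ + σ ζ₂ = 0 := by
    rw [hζ₂]; split_ifs
    · rw [map_inv₀, hθ, inv_neg, add_neg_cancel]
    · rw [map_zero, add_zero]
  obtain ⟨p₁, hp₁def⟩ : ∃ p₁ : K, p₁ = p₀ + ζ₂ * θ₀ * r := ⟨_, rfl⟩
  have hp₁ : p₁ ≠ 0 := by
    rw [hp₁def, hζ₂]
    split_ifs with h0
    · -- `p₀ = 0` forces `r ≠ 0`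
      have R3 := coeff_rel_of_pair B hB he hf hef hθ hθ0 p₀ r q₀ s₀ (by rw [← hke, ← hkf, hk, hef])
      intro hzero
      have hr0 : r = 0 := by rwa [h0, zero_add, inv_mul_cancel₀ hθ0, one_mul] at hzero
      simp [h0, hr0] at R3
    · rwa [zero_mul, zero_mul, add_zero]
  have hσp₁ : σ p₁ ≠ 0 := fun h => hp₁ (by simpa [hσ] using congrArg σ h)
  obtain ⟨t₂, ht₂def⟩ : ∃ t : Module.End K V,
      t = (1 : Module.End K V) + (B e).smulRight (0 : V) + (ζ₂ • B e - B (0 : V)).smulRight e := ⟨_, rfl⟩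
  have ht₂ : ∀ x y, B (t₂ x) (t₂ y) = B x y := by rw [ht₂def]; exact transv_isometry B hB e he ζ₂ hζ₂s
  have hk₁e : (t₂ * k) e = p₁ • e + r • f := by
    rw [Module.End.mul_apply, hke, ht₂def, transv_e_apply_pair B he hef ζ₂ p₀ r, hp₁def]
  -- second transvection (on `f`): kill the `f`-coefficient
  have R1 := coeff_rel_of_isotropic B hB he hf hef hθ hθ0 p₁ r
    (by rw [← hk₁e, isometry_mul B _ _ ht₂ hk, he])
  obtain ⟨ζ₁, hζ₁⟩ : ∃ ζ₁ : K, ζ₁ = r * (θ₀ * p₁)⁻¹ := ⟨_, rfl⟩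
  have hσr : σ r = σ p₁ * r * p₁⁻¹ := by rw [eq_mul_inv_iff_mul_eq₀ hp₁]; exact R1.symm
  have hζ₁s : ζ₁ + σ ζ₁ = 0 := by
    rw [hζ₁, map_mul, map_inv₀, map_mul, hθ, hσr]
    field_simp
    ring
  obtain ⟨t₁, ht₁def⟩ : ∃ t : Module.End K V,
      t = (1 : Module.End K V) + (B f).smulRight (0 : V) + (ζ₁ • B f - B (0 : V)).smulRight f := ⟨_, rfl⟩
  have ht₁ : ∀ x y, B (t₁ x) (t₁ y) = B x y := by rw [ht₁def]; exact transv_isometry B hB f hf ζ₁ hζ₁s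
  have hk₂e : (t₁ * (t₂ * k)) e = p₁ • e := by
    rw [Module.End.mul_apply, hk₁e, ht₁def, transv_f_apply_pair B hB hf hef hθ, hζ₁]
    have : r - r * (θ₀ * p₁)⁻¹ * θ₀ * p₁ = 0 := by field_simp; ring
    rw [this, zero_smul, add_zero]
  have hk₂ : ∀ x y, B ((t₁ * (t₂ * k)) x) ((t₁ * (t₂ * k)) y) = B x y :=
    isometry_mul B _ _ ht₁ (isometry_mul B _ _ ht₂ hk)
  have hW0 : ∀ w : V, B (0 : V) w = 0 := fun w => by rw [map_zero, LinearMap.zero_apply]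
  have hk₂W : ∀ w, B e w = 0 → B f w = 0 → (t₁ * (t₂ * k)) w = w := by
    intro w hw1 hw2
    rw [Module.End.mul_apply, Module.End.mul_apply, hkW w hw1 hw2, ht₂def, root_apply_of_orth B e 0 _ hw1 (hW0 w),
      ht₁def, root_apply_of_orth B f 0 _ hw2 (hW0 w)]
  obtain ⟨-, ζ₃, hζ₃s, hnorm⟩ := fixW_eq_dil_mul_transv B hB hσ hBnd he hf hef hθ hθ0 _ hk₂ hk₂W p₁ hk₂e
  have ht₃ : ∀ x y, B (((1 : Module.End K V) + (B e).smulRight (0 : V) + (ζ₃ • B e - B (0 : V)).smulRight e) x)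
      (((1 : Module.End K V) + (B e).smulRight (0 : V) + (ζ₃ • B e - B (0 : V)).smulRight e) y) = B x y :=
    transv_isometry B hB e he ζ₃ hζ₃s
  have hD : ∀ x y, B (((1 : Module.End K V) + ((1 - p₁) * θ₀⁻¹) • (B f).smulRight e +
      (((σ p₁)⁻¹ - 1) * θ₀⁻¹) • (B e).smulRight f) x) (((1 : Module.End K V) + ((1 - p₁) * θ₀⁻¹) • (B f).smulRight e +
      (((σ p₁)⁻¹ - 1) * θ₀⁻¹) • (B e).smulRight f) y) = B x y := dil_isometry B hB hσ he hf hef hθ hθ0 p₁ hp₁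
  refine ⟨p₁, hp₁, ?_, ?_⟩
  · -- determinants
    have hdet := congrArg LinearMap.det hnorm
    rw [map_mul, map_mul, map_mul, ht₁def, ht₂def, det_root B hB f 0 ζ₁ hf (map_zero _),
      det_root B hB e 0 ζ₂ he (map_zero _), det_root B hB e 0 ζ₃ he (map_zero _), det_dil B hB hf hef hθ hθ0, one_mul,
      one_mul, mul_one] at hdet
    exact hdet
  · -- the character
    have hc := congrArg χ hnorm
    rw [hχ _ _ ht₁ (isometry_mul B _ _ ht₂ hk), hχ _ _ ht₂ hk, hχ _ _ hD ht₃, ht₁def, ht₂def,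
      chi_transv_f B χ hχ hB hσ h2 he hf hef hθ hθ0 ζ₁ hζ₁s, chi_transv_e B χ hχ hB hσ h2 he hf hef hθ hθ0 ζ₂ hζ₂s,
      chi_transv_e B χ hχ hB hσ h2 he hf hef hθ hθ0 ζ₃ hζ₃s, one_mul, one_mul, mul_one] at hc
    exact hc

include hχ hB hσ hBnd h2 he hf hef hθ hθ0 in
/-- **Isometries fixing `{e, f}^⊥` with the same determinant have the same `χ`** (`SL₂(K^σ) ≤ ker χ` on the
hyperbolic plane). [cite: Dieudonne1971GroupesClassiques, Chap. II §5] -/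
theorem chi_eq_of_fixW_of_det_eq [FiniteDimensional K V] (k k' : Module.End K V)
    (hk : ∀ x y, B (k x) (k y) = B x y) (hkW : ∀ w, B e w = 0 → B f w = 0 → k w = w)
    (hk' : ∀ x y, B (k' x) (k' y) = B x y) (hk'W : ∀ w, B e w = 0 → B f w = 0 → k' w = w)
    (hdet : LinearMap.det k = LinearMap.det k') : χ k = χ k' := by
  obtain ⟨p, hp, hd, hc⟩ := exists_det_eq_and_chi_eq B χ hχ hB hσ hBnd h2 he hf hef hθ hθ0 k hk hkW
  obtain ⟨p', hp', hd', hc'⟩ := exists_det_eq_and_chi_eq B χ hχ hB hσ hBnd h2 he hf hef hθ hθ0 k' hk' hk'W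
  have hσp : σ p ≠ 0 := fun h => hp (by simpa [hσ] using congrArg σ h)
  have hσp' : σ p' ≠ 0 := fun h => hp' (by simpa [hσ] using congrArg σ h)
  rw [hd, hd'] at hdet
  -- `β = p / p'` is `σ`-fixed
  have hβ : σ (p * p'⁻¹) = p * p'⁻¹ := by
    rw [map_mul, map_inv₀]
    field_simp
    field_simp at hdet
    linear_combination -hdet
  have hβ0 : p * p'⁻¹ ≠ 0 := mul_ne_zero hp (inv_ne_zero hp')
  have hsplit := dil_mul_dil B hB he hf hef hθ hθ0 p' (p * p'⁻¹)
  have hpp : p' * (p * p'⁻¹) = p := by field_simp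
  rw [hpp] at hsplit
  rw [hc, hc', ← hsplit, hχ _ _ (dil_isometry B hB hσ he hf hef hθ hθ0 p' hp') (dil_isometry B hB hσ he hf hef hθ hθ0 _ hβ0),
    chi_dil_of_fixed B χ hχ hB hσ h2 he hf hef hθ hθ0 _ hβ hβ0, mul_one]

include hχ hB hσ hBnd h2 he hf hef hθ hθ0 in
/-- … in particular an isometry fixing `{e, f}^⊥` of determinant `1` is killed. [cite: Dieudonne1971GroupesClassiques, Chap. II §5] -/
theorem chi_eq_one_of_fixW [FiniteDimensional K V] (k : Module.End K V) (hk : ∀ x y, B (k x) (k y) = B x y)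
    (hkW : ∀ w, B e w = 0 → B f w = 0 → k w = w) (hdet : LinearMap.det k = 1) : χ k = 1 := by
  rw [chi_eq_of_fixW_of_det_eq B χ hχ hB hσ hBnd h2 he hf hef hθ hθ0 k 1 hk hkW (isometry_one B)
    (fun w _ _ => Module.End.one_apply w) (by rw [hdet, map_one]), chi_one B χ hχ]

end PlaneFix

/-! ## §8 Complementary submodules: extension of endomorphisms, restriction of the form -/

/-- Two endomorphisms agreeing on complementary submodules are equal. [folklore] -/
private theorem eq_of_isCompl (W W' : Submodule K V) (hc : IsCompl W W') (T₁ T₂ : Module.End K V)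
    (h₁ : ∀ w ∈ W, T₁ w = T₂ w) (h₂ : ∀ y ∈ W', T₁ y = T₂ y) : T₁ = T₂ := by
  ext x
  have hx : x ∈ W ⊔ W' := by rw [hc.sup_eq_top]; exact Submodule.mem_top
  obtain ⟨w, hw, y, hy, rfl⟩ := Submodule.mem_sup.1 hx
  rw [map_add, map_add, h₁ w hw, h₂ y hy]

/-- **Extension by the identity**: for complementary `W, W'` there is a monoid homomorphism
`ι : End W →* End V` with `ι h = h` on `W`, `ι h = id` on `W'`, and `det (ι h) = det h`. [folklore] -/
private theorem exists_extension [FiniteDimensional K V] (W W' : Submodule K V) (hc : IsCompl W W') :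
    ∃ ι : Module.End K W →* Module.End K V,
      (∀ (h : Module.End K W) (w : W), ι h (w : V) = (h w : V)) ∧
      (∀ (h : Module.End K W) (y : V), y ∈ W' → ι h y = y) ∧
      ∀ h : Module.End K W, LinearMap.det (ι h) = LinearMap.det h := by
  let E := Submodule.prodEquivOfIsCompl W W' hc
  have hval : ∀ (h : Module.End K W) (x : V),
      E.conj (h.prodMap (1 : Module.End K W')) x = E ((h.prodMap (1 : Module.End K W')) (E.symm x)) := by
    intro h x; rw [LinearEquiv.conj_apply]; rfl
  refine ⟨{ toFun := fun h => E.conj (h.prodMap (1 : Module.End K W'))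
            map_one' := ?_
            map_mul' := ?_ }, ?_, ?_, ?_⟩
  · ext x
    rw [hval, LinearMap.prodMap_apply, Module.End.one_apply, Module.End.one_apply, Prod.mk.eta,
      LinearEquiv.apply_symm_apply, Module.End.one_apply]
  · intro h h'
    ext x
    simp only [Module.End.mul_apply, hval, LinearEquiv.symm_apply_apply]
    rfl
  · intro h w
    simp only [MonoidHom.coe_mk, OneHom.coe_mk, hval, Submodule.prodEquivOfIsCompl_symm_apply_left,
      LinearMap.prodMap_apply, Submodule.coe_prodEquivOfIsCompl', map_zero, Submodule.coe_zero, add_zero, E]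
  · intro h y hy
    have := Submodule.prodEquivOfIsCompl_symm_apply_right W W' hc ⟨y, hy⟩
    simp only [MonoidHom.coe_mk, OneHom.coe_mk, hval, E]
    rw [show (y : V) = ((⟨y, hy⟩ : W') : V) from rfl, this, LinearMap.prodMap_apply, map_zero,
      Submodule.coe_prodEquivOfIsCompl', Submodule.coe_zero, zero_add, Module.End.one_apply]
  · intro h
    simp only [MonoidHom.coe_mk, OneHom.coe_mk]
    rw [LinearEquiv.conj_apply, LinearMap.comp_assoc, LinearMap.det_conj, LinearMap.det_prodMap, map_one, mul_one]

/-- **Extensions of isometries are isometries** when `W ⊥ W'`. [folklore] -/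
private theorem extension_isometry (B : V →ₛₗ[σ] V →ₗ[K] K) (hB : ∀ x y, σ (B x y) = B y x) (W W' : Submodule K V)
    (hc : IsCompl W W') (horth : ∀ w ∈ W, ∀ y ∈ W', B w y = 0) (ι : Module.End K W →* Module.End K V)
    (hι₁ : ∀ (h : Module.End K W) (w : W), ι h (w : V) = (h w : V))
    (hι₂ : ∀ (h : Module.End K W) (y : V), y ∈ W' → ι h y = y) (h : Module.End K W)
    (hh : ∀ x y : W, B ((h x : W) : V) ((h y : W) : V) = B (x : V) (y : V)) (x y : V) :
    B (ι h x) (ι h y) = B x y := by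
  have hx : x ∈ W ⊔ W' := by rw [hc.sup_eq_top]; exact Submodule.mem_top
  have hy : y ∈ W ⊔ W' := by rw [hc.sup_eq_top]; exact Submodule.mem_top
  obtain ⟨w, hw, x', hx', rfl⟩ := Submodule.mem_sup.1 hx
  obtain ⟨v, hv, y', hy', rfl⟩ := Submodule.mem_sup.1 hy
  have horth' : ∀ y ∈ W', ∀ w ∈ W, B y w = 0 := fun y hy w hw => apply_eq_zero_comm B hB (horth w hw y hy)
  have e1 : ι h (w + x') = ((h ⟨w, hw⟩ : W) : V) + x' := by rw [map_add, hι₂ h x' hx', ← hι₁ h ⟨w, hw⟩]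
  have e2 : ι h (v + y') = ((h ⟨v, hv⟩ : W) : V) + y' := by rw [map_add, hι₂ h y' hy', ← hι₁ h ⟨v, hv⟩]
  have o1 : B ((h ⟨w, hw⟩ : W) : V) y' = 0 := horth _ (h _).2 _ hy'
  have o2 : B x' ((h ⟨v, hv⟩ : W) : V) = 0 := horth' _ hx' _ (h _).2
  have o3 : B w y' = 0 := horth _ hw _ hy'
  have o4 : B x' v = 0 := horth' _ hx' _ hv
  have hh' := hh ⟨w, hw⟩ ⟨v, hv⟩
  rw [e1, e2, apply_add_left, apply_add_left, map_add, map_add, map_add, map_add, hh', o1, o2, o3, o4]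

/-- The complement `{e, f}^⊥ = ker (B e) ⊓ ker (B f)` and the plane `span {e, f}` are complementary. [folklore] -/
private theorem isCompl_pair (B : V →ₛₗ[σ] V →ₗ[K] K) (hB : ∀ x y, σ (B x y) = B y x) {e f : V} {θ₀ : K}
    (he : B e e = 0) (hf : B f f = 0) (hef : B e f = θ₀) (hθ : σ θ₀ = -θ₀) (hθ0 : θ₀ ≠ 0) :
    IsCompl (LinearMap.ker (B e) ⊓ LinearMap.ker (B f)) (Submodule.span K {e, f}) := by
  have hfe := apply_fe B hB hef hθ
  refine isCompl_iff.2 ⟨?_, ?_⟩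
  · rw [Submodule.disjoint_def]
    intro x hx hx'
    obtain ⟨a, b, rfl⟩ := Submodule.mem_span_pair.1 hx'
    obtain ⟨h1, h2⟩ := Submodule.mem_inf.1 hx
    rw [LinearMap.mem_ker, map_add, map_smul, map_smul, he, hef, smul_zero, zero_add, smul_eq_mul] at h1
    rw [LinearMap.mem_ker, map_add, map_smul, map_smul, hf, hfe, smul_zero, add_zero, smul_eq_mul, mul_neg,
      neg_eq_zero] at h2
    rw [(mul_eq_zero.1 h1).resolve_right hθ0, (mul_eq_zero.1 h2).resolve_right hθ0, zero_smul, zero_smul, add_zero]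
  · rw [codisjoint_iff, Submodule.eq_top_iff']
    intro y
    obtain ⟨h1, h2⟩ := proj_orth B hB he hf hef hθ hθ0 y
    have : y = (y + (B f y * θ₀⁻¹) • e - (B e y * θ₀⁻¹) • f) + ((-(B f y * θ₀⁻¹)) • e + (B e y * θ₀⁻¹) • f) := by
      rw [neg_smul]; abel
    rw [this]
    exact Submodule.add_mem_sup (Submodule.mem_inf.2 ⟨h1, h2⟩) (Submodule.mem_span_pair.2 ⟨_, _, rfl⟩)

/-- `{e, f}^⊥ ⊥ span {e, f}`. [folklore] -/
private theorem orth_pair (B : V →ₛₗ[σ] V →ₗ[K] K) (hB : ∀ x y, σ (B x y) = B y x) (e f : V)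
    (w : V) (hw : w ∈ LinearMap.ker (B e) ⊓ LinearMap.ker (B f)) (y : V) (hy : y ∈ Submodule.span K {e, f}) :
    B w y = 0 := by
  obtain ⟨a, b, rfl⟩ := Submodule.mem_span_pair.1 hy
  obtain ⟨h1, h2⟩ := Submodule.mem_inf.1 hw
  rw [LinearMap.mem_ker] at h1 h2
  rw [map_add, map_smul, map_smul, apply_eq_zero_comm B hB h1, apply_eq_zero_comm B hB h2, smul_zero, smul_zero,
    add_zero]

/-- For anisotropic `a`, `ker (B a)` and the line `K a` are complementary. [folklore] -/
private theorem isCompl_line (B : V →ₛₗ[σ] V →ₗ[K] K) (a : V) (ha : B a a ≠ 0) :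
    IsCompl (LinearMap.ker (B a)) (K ∙ a) := by
  refine isCompl_iff.2 ⟨?_, ?_⟩
  · rw [Submodule.disjoint_def]
    intro x hx hx'
    obtain ⟨c, rfl⟩ := Submodule.mem_span_singleton.1 hx'
    rw [LinearMap.mem_ker, map_smul, smul_eq_mul] at hx
    rw [(mul_eq_zero.1 hx).resolve_right ha, zero_smul]
  · rw [codisjoint_iff, Submodule.eq_top_iff']
    intro y
    have : y = (y - (B a y * (B a a)⁻¹) • a) + (B a y * (B a a)⁻¹) • a := by abel
    rw [this]
    refine Submodule.add_mem_sup ?_ (Submodule.mem_span_singleton.2 ⟨_, rfl⟩)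
    rw [LinearMap.mem_ker, map_sub, map_smul, smul_eq_mul, inv_mul_cancel_right₀ ha, sub_self]

/-- `ker (B a) ⊥ K a`. [folklore] -/
private theorem orth_line (B : V →ₛₗ[σ] V →ₗ[K] K) (hB : ∀ x y, σ (B x y) = B y x) (a : V)
    (w : V) (hw : w ∈ LinearMap.ker (B a)) (y : V) (hy : y ∈ K ∙ a) : B w y = 0 := by
  obtain ⟨c, rfl⟩ := Submodule.mem_span_singleton.1 hy
  rw [LinearMap.mem_ker] at hw
  rw [map_smul, apply_eq_zero_comm B hB hw, smul_zero]

/-- The extension of a quasi-symmetry of `W` is the quasi-symmetry of `V` (`W ⊥ W'`). [folklore] -/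
private theorem extension_quasi (B : V →ₛₗ[σ] V →ₗ[K] K) (W W' : Submodule K V)
    (hc : IsCompl W W') (horth : ∀ w ∈ W, ∀ y ∈ W', B w y = 0) (ι : Module.End K W →* Module.End K V)
    (hι₁ : ∀ (h : Module.End K W) (w : W), ι h (w : V) = (h w : V))
    (hι₂ : ∀ (h : Module.End K W) (y : V), y ∈ W' → ι h y = y) (a : W) (μ : K) :
    ι ((1 : Module.End K W) + ((μ - 1) * (B.domRestrict₁₂ W W a a)⁻¹) • (B.domRestrict₁₂ W W a).smulRight a) =
      (1 : Module.End K V) + ((μ - 1) * (B (a : V) (a : V))⁻¹) • (B (a : V)).smulRight (a : V) := by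
  refine eq_of_isCompl W W' hc _ _ (fun w hw => ?_) (fun y hy => ?_)
  · rw [show w = ((⟨w, hw⟩ : W) : V) from rfl, hι₁, quasi_apply, quasi_apply]
    simp only [LinearMap.domRestrict₁₂_apply, Submodule.coe_add, Submodule.coe_smul]
  · rw [hι₂ _ y hy, quasi_apply_of_orth B _ _ (horth _ a.2 _ hy)]

/-! ## §9 Moving an isotropic vector onto the line `K u'` by one root element; the reduction to the Levi factor -/

/-- **One root element moves an isotropic vector with non-zero `u`-coordinate onto the line `K u'`**:
for a pair `B u u = B u' u' = 0`, `B u u' = θ` (`σθ = −θ ≠ 0`) and `x = x_W + c u' + d u` isotropic with `x_W ⊥ u, u'`,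
`c ≠ 0`, there is an admissible `(w, z)` with `w ⊥ u, u'` and `T(u, w, z) x = c u'`.
[cite: Dieudonne1971GroupesClassiques, Chap. II §5] -/
theorem root_to_line (B : V →ₛₗ[σ] V →ₗ[K] K) (hB : ∀ x y, σ (B x y) = B y x) (hσ : ∀ x, σ (σ x) = x)
    {u u' : V} {θ : K} (hu : B u u = 0) (hu' : B u' u' = 0) (huu' : B u u' = θ) (hθσ : σ θ = -θ) (hθ0 : θ ≠ 0)
    (xW : V) (c d : K) (hc : c ≠ 0) (h1 : B u xW = 0) (h2 : B u' xW = 0)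
    (hxx : B (xW + c • u' + d • u) (xW + c • u' + d • u) = 0) :
    ∃ (w : V) (z : K), B u w = 0 ∧ B u' w = 0 ∧ z + σ z + B w w = 0 ∧
      ((1 : Module.End K V) + (B u).smulRight w + (z • B u - B w).smulRight u) (xW + c • u' + d • u) = c • u' := by
  have hu'u : B u' u = -θ := by rw [← hB u u', huu', hθσ]
  have h1' : B xW u = 0 := apply_eq_zero_comm B hB h1
  have h2' : B xW u' = 0 := apply_eq_zero_comm B hB h2
  have hNσ : σ (B xW xW) = B xW xW := hB xW xW
  have hσc : σ c ≠ 0 := fun h => hc (by simpa [hσ] using congrArg σ h)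
  -- `B x x = 0` read on the coordinates
  have hN : B xW xW = σ c * d * θ - σ d * c * θ := by
    simp only [map_add, LinearMap.map_smulₛₗ, map_smul, LinearMap.add_apply, LinearMap.smul_apply, smul_eq_mul, h1, h2,
      h1', h2', hu, hu', huu', hu'u] at hxx
    linear_combination hxx
  obtain ⟨w, hw⟩ : ∃ w : V, w = (-(c * θ)⁻¹) • xW := ⟨_, rfl⟩
  have hwu : B u w = 0 := by rw [hw, map_smul, h1, smul_zero]
  have hwu' : B u' w = 0 := by rw [hw, map_smul, h2, smul_zero]
  have hBwu : B w u = 0 := apply_eq_zero_comm B hB hwu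
  have hBwu' : B w u' = 0 := apply_eq_zero_comm B hB hwu'
  have hBwW : B w xW = (σ c * θ)⁻¹ * B xW xW := by
    rw [hw, apply_smul_left, map_neg, map_inv₀, map_mul, hθσ]; congr 1; field_simp
  have hBww : B w w = -((σ c * θ)⁻¹ * (c * θ)⁻¹) * B xW xW := by
    rw [hw, apply_smul_left, apply_smul_right, map_neg, map_inv₀, map_mul, hθσ]
    field_simp
  obtain ⟨z, hz⟩ : ∃ z : K, z = ((σ c * θ)⁻¹ * B xW xW - d) * (c * θ)⁻¹ := ⟨_, rfl⟩
  refine ⟨w, z, hwu, hwu', ?_, ?_⟩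
  · rw [hBww, hz, map_mul, map_sub, map_mul, map_inv₀, map_inv₀, map_mul, map_mul, hσ, hθσ, hNσ, hN]
    field_simp
    ring
  · rw [root_apply]
    have eBux : B u (xW + c • u' + d • u) = c * θ := by
      rw [map_add, map_add, map_smul, map_smul, h1, huu', hu, smul_eq_mul, smul_zero, zero_add, add_zero]
    have eBwx : B w (xW + c • u' + d • u) = (σ c * θ)⁻¹ * B xW xW := by
      rw [map_add, map_add, map_smul, map_smul, hBwW, hBwu, hBwu', smul_zero, smul_zero, add_zero, add_zero]
    have e1 : (c * θ) • w = -xW := by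
      rw [hw, smul_smul, mul_neg, mul_inv_cancel₀ (mul_ne_zero hc hθ0), neg_one_smul]
    have e2 : z * (c * θ) - (σ c * θ)⁻¹ * B xW xW = -d := by
      rw [hz]; field_simp; ring
    rw [eBux, eBwx, e1, e2]
    module

/-- **Coordinates along a hyperbolic pair**: `x = x_W − (B f x/θ₀) e + (B e x/θ₀) f` with `x_W ⊥ e, f`. [folklore] -/
private theorem decomp_pair (B : V →ₛₗ[σ] V →ₗ[K] K) (hB : ∀ x y, σ (B x y) = B y x) {e f : V} {θ₀ : K}
    (he : B e e = 0) (hf : B f f = 0) (hef : B e f = θ₀) (hθ : σ θ₀ = -θ₀) (hθ0 : θ₀ ≠ 0) (x : V) :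
    ∃ xW : V, B e xW = 0 ∧ B f xW = 0 ∧ x = xW + (-(B f x * θ₀⁻¹)) • e + (B e x * θ₀⁻¹) • f := by
  obtain ⟨h1, h2⟩ := proj_orth B hB he hf hef hθ hθ0 x
  exact ⟨_, h1, h2, by rw [neg_smul]; abel⟩

/-- … the same with the `f`-coordinate written first. [folklore] -/
private theorem decomp_pair' (B : V →ₛₗ[σ] V →ₗ[K] K) (hB : ∀ x y, σ (B x y) = B y x) {e f : V} {θ₀ : K}
    (he : B e e = 0) (hf : B f f = 0) (hef : B e f = θ₀) (hθ : σ θ₀ = -θ₀) (hθ0 : θ₀ ≠ 0) (x : V) :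
    ∃ xW : V, B e xW = 0 ∧ B f xW = 0 ∧ x = xW + (B e x * θ₀⁻¹) • f + (-(B f x * θ₀⁻¹)) • e := by
  obtain ⟨h1, h2⟩ := proj_orth B hB he hf hef hθ hθ0 x
  exact ⟨_, h1, h2, by rw [neg_smul]; abel⟩

section Reduce

variable {A : Type*} [CommGroup A] (B : V →ₛₗ[σ] V →ₗ[K] K) (χ : Module.End K V → A)
  (hχ : ∀ g h : Module.End K V, (∀ x y, B (g x) (g y) = B x y) → (∀ x y, B (h x) (h y) = B x y) →
    χ (g * h) = χ g * χ h)
  (hB : ∀ x y, σ (B x y) = B y x) (hσ : ∀ x, σ (σ x) = x) (hBnd : ∀ x, (∀ y, B x y = 0) → x = 0)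
  (h2 : (2 : K) ≠ 0)
  {e f : V} {θ₀ : K} (he : B e e = 0) (hf : B f f = 0) (hef : B e f = θ₀) (hθ : σ θ₀ = -θ₀) (hθ0 : θ₀ ≠ 0)
include hχ hB hσ h2 he hf hef hθ hθ0

/-- **Reduction, step 1**: every non-zero isotropic `x` is moved into the line `K e` by a product `t` of at most three
root elements — an isometry of determinant `1` killed by `χ`. [cite: Dieudonne1971GroupesClassiques, Chap. II §5] -/
theorem exists_killed_apply_mem_line [FiniteDimensional K V] (hBnd : ∀ x, (∀ y, B x y = 0) → x = 0) (x : V)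
    (hx0 : x ≠ 0) (hxx : B x x = 0) :
    ∃ t : Module.End K V, (∀ x y, B (t x) (t y) = B x y) ∧ χ t = 1 ∧ LinearMap.det t = 1 ∧ ∃ p : K, t x = p • e := by
  have hfe := apply_fe B hB hef hθ
  have hθ' : σ (-θ₀) = -(-θ₀) := by rw [map_neg, hθ]
  have hθ0' : -θ₀ ≠ 0 := neg_ne_zero.2 hθ0
  -- case A: `B f x ≠ 0`
  have caseA : ∀ x : V, B x x = 0 → B f x ≠ 0 →
      ∃ t : Module.End K V, (∀ x y, B (t x) (t y) = B x y) ∧ χ t = 1 ∧ LinearMap.det t = 1 ∧ ∃ p : K, t x = p • e := by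
    intro x hxx hfx
    obtain ⟨xW, hW1, hW2, hx⟩ := decomp_pair B hB he hf hef hθ hθ0 x
    have hc : -(B f x * θ₀⁻¹) ≠ 0 := neg_ne_zero.2 (mul_ne_zero hfx (inv_ne_zero hθ0))
    have hxx' : B (xW + (-(B f x * θ₀⁻¹)) • e + (B e x * θ₀⁻¹) • f)
        (xW + (-(B f x * θ₀⁻¹)) • e + (B e x * θ₀⁻¹) • f) = 0 := by rw [← hx]; exact hxx
    obtain ⟨w, z, hw1, hw2, hz, hT⟩ :=
      root_to_line B hB hσ hf he hfe hθ' hθ0' xW _ _ hc hW2 hW1 hxx'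
    refine ⟨_, root_isometry B hB f w z hf hw1 hz, chi_root_f B χ hχ hB hσ h2 he hf hef hθ hθ0 w hw2 hw1 z hz,
      det_root B hB f w z hf hw1, -(B f x * θ₀⁻¹), ?_⟩
    conv_lhs => rw [hx]
    exact hT
  -- case B: `B f x = 0`, `B e x ≠ 0`
  have caseB : ∀ x : V, B x x = 0 → B f x = 0 → B e x ≠ 0 →
      ∃ t : Module.End K V, (∀ x y, B (t x) (t y) = B x y) ∧ χ t = 1 ∧ LinearMap.det t = 1 ∧ ∃ p : K, t x = p • e := by
    intro x hxx hfx hex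
    have hsk : θ₀⁻¹ + σ θ₀⁻¹ = 0 := by rw [map_inv₀, hθ, inv_neg, add_neg_cancel]
    obtain ⟨t₀, ht₀⟩ : ∃ t : Module.End K V,
        t = (1 : Module.End K V) + (B e).smulRight (0 : V) + (θ₀⁻¹ • B e - B (0 : V)).smulRight e := ⟨_, rfl⟩
    have ht₀i : ∀ x y, B (t₀ x) (t₀ y) = B x y := by rw [ht₀]; exact transv_isometry B hB e he _ hsk
    have hx₁ : t₀ x = x + (θ₀⁻¹ * B e x) • e := by rw [ht₀, transv_apply]
    have hfx₁ : B f (t₀ x) ≠ 0 := by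
      have : B f (t₀ x) = -B e x := by
        rw [hx₁, map_add, map_smul, hfx, hfe, zero_add, smul_eq_mul]; field_simp
      rw [this]; exact neg_ne_zero.2 hex
    obtain ⟨t, hti, htχ, htd, p, htp⟩ := caseA (t₀ x) (by rw [ht₀i, hxx]) hfx₁
    refine ⟨t * t₀, isometry_mul B _ _ hti ht₀i, ?_, ?_, p, by rw [Module.End.mul_apply, htp]⟩
    · rw [hχ _ _ hti ht₀i, htχ, ht₀, chi_transv_e B χ hχ hB hσ h2 he hf hef hθ hθ0 _ hsk, one_mul]
    · rw [map_mul, htd, ht₀, det_root B hB e 0 _ he (map_zero _), one_mul]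
  -- case C: `x ∈ {e, f}^⊥`
  by_cases hfx : B f x ≠ 0
  · exact caseA x hxx hfx
  by_cases hex : B e x ≠ 0
  · exact caseB x hxx (not_not.1 hfx) hex
  rw [not_not] at hfx hex
  obtain ⟨w₂, hw₂1, hw₂2, hw₂x⟩ : ∃ w₂ : V, B e w₂ = 0 ∧ B f w₂ = 0 ∧ B w₂ x ≠ 0 := by
    by_contra hcon
    push Not at hcon
    exact hx0 (eq_zero_of_orth B hB hBnd he hf hef hθ hθ0 x hex hfx fun w hw1 hw2 =>
      apply_eq_zero_comm B hB (hcon w hw1 hw2))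
  have h2σ : σ 2 = 2 := map_ofNat σ 2
  have hz₂ : -(B w₂ w₂) * 2⁻¹ + σ (-(B w₂ w₂) * 2⁻¹) + B w₂ w₂ = 0 := by
    rw [map_mul, map_neg, map_inv₀, h2σ, hB w₂ w₂]
    linear_combination (-(B w₂ w₂)) * inv_mul_cancel₀ h2
  obtain ⟨t₁, ht₁⟩ : ∃ t : Module.End K V,
      t = (1 : Module.End K V) + (B f).smulRight w₂ + ((-(B w₂ w₂) * 2⁻¹) • B f - B w₂).smulRight f := ⟨_, rfl⟩
  have ht₁i : ∀ x y, B (t₁ x) (t₁ y) = B x y := by rw [ht₁]; exact root_isometry B hB f w₂ _ hf hw₂2 hz₂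
  have hx₂ : t₁ x = x - (B w₂ x) • f := by
    rw [ht₁, root_apply, hfx, zero_smul, add_zero, mul_zero, zero_sub, neg_smul, sub_eq_add_neg]
  have hfx₂ : B f (t₁ x) = 0 := by rw [hx₂, map_sub, map_smul, hfx, hf, smul_zero, sub_zero]
  have hex₂ : B e (t₁ x) ≠ 0 := by
    rw [hx₂, map_sub, map_smul, hex, hef, zero_sub, smul_eq_mul]
    exact neg_ne_zero.2 (mul_ne_zero hw₂x hθ0)
  obtain ⟨t, hti, htχ, htd, p, htp⟩ := caseB (t₁ x) (by rw [ht₁i, hxx]) hfx₂ hex₂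
  refine ⟨t * t₁, isometry_mul B _ _ hti ht₁i, ?_, ?_, p, by rw [Module.End.mul_apply, htp]⟩
  · rw [hχ _ _ hti ht₁i, htχ, ht₁, chi_root_f B χ hχ hB hσ h2 he hf hef hθ hθ0 w₂ hw₂1 hw₂2 _ hz₂, one_mul]
  · rw [map_mul, htd, ht₁, det_root B hB f w₂ _ hf hw₂2, one_mul]

/-- **Reduction, step 2**: for an isometry `g` with `g e = p e` there is a root element on `e` (killed by `χ`,
determinant `1`) with `T (g f) = (σp)⁻¹ f`; and `p ≠ 0`. [cite: Dieudonne1971GroupesClassiques, Chap. II §5] -/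
theorem exists_killed_apply_eq_f [FiniteDimensional K V] (g : Module.End K V) (hg : ∀ x y, B (g x) (g y) = B x y)
    (p : K) (hge : g e = p • e) :
    p ≠ 0 ∧ ∃ t : Module.End K V, (∀ x y, B (t x) (t y) = B x y) ∧ χ t = 1 ∧ LinearMap.det t = 1 ∧ t e = e ∧
      t (g f) = (σ p)⁻¹ • f := by
  obtain ⟨yW, hW1, hW2, hy⟩ := decomp_pair' B hB he hf hef hθ hθ0 (g f)
  have hegf : B e (g f) = θ₀ * (σ p)⁻¹ := by
    have h := hg e f
    rw [hge, apply_smul_left, hef] at h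
    have hσp : σ p ≠ 0 := fun h0 => by rw [h0, zero_mul] at h; exact hθ0 h.symm
    rw [eq_mul_inv_iff_mul_eq₀ hσp, mul_comm]; exact h
  have hp : p ≠ 0 := by
    rintro rfl
    have h := hg e f
    rw [hge, zero_smul, map_zero, LinearMap.zero_apply, hef] at h
    exact hθ0 h.symm
  have hσp : σ p ≠ 0 := fun h => hp (by simpa [hσ] using congrArg σ h)
  have hc : B e (g f) * θ₀⁻¹ ≠ 0 := mul_ne_zero (by rw [hegf]; exact mul_ne_zero hθ0 (inv_ne_zero hσp)) (inv_ne_zero hθ0)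
  have hyy : B (yW + (B e (g f) * θ₀⁻¹) • f + (-(B f (g f) * θ₀⁻¹)) • e)
      (yW + (B e (g f) * θ₀⁻¹) • f + (-(B f (g f) * θ₀⁻¹)) • e) = 0 := by rw [← hy, hg, hf]
  obtain ⟨w, z, hw1, hw2, hz, hT⟩ := root_to_line B hB hσ he hf hef hθ hθ0 yW _ _ hc hW1 hW2 hyy
  refine ⟨hp, _, root_isometry B hB e w z he hw1 hz, chi_root_e B χ hχ hB hσ h2 he hf hef hθ hθ0 w hw1 hw2 z hz,
    det_root B hB e w z he hw1, root_apply_self B hB e w z he hw1, ?_⟩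
  rw [hy, hT, hegf]
  congr 1
  field_simp

end Reduce

/-! ## §10 The anisotropic Cartan–Dieudonné theorem: isometries of an anisotropic space are products of quasi-symmetries -/

/-- **Anisotropic Cartan–Dieudonné** (induction form): on an ANISOTROPIC non-degenerate hermitian space every isometry
lies in every class of endomorphisms containing `1` and stable under left multiplication by quasi-symmetries
(`2 ≠ 0`, `σ` an involution). [cite: Dieudonne1971GroupesClassiques, Chap. II §4] -/
theorem aniso_cartan_dieudonne (hσ : ∀ x : K, σ (σ x) = x) (h2 : (2 : K) ≠ 0) :
    ∀ (d : ℕ) {V : Type u} [AddCommGroup V] [Module K V] [FiniteDimensional K V],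
      Module.finrank K V = d → ∀ (B : V →ₛₗ[σ] V →ₗ[K] K), (∀ x y, σ (B x y) = B y x) →
      (∀ x, B x x = 0 → x = 0) →
      ∀ (P : Module.End K V → Prop), P 1 →
        (∀ (a : V) (μ : K) (k : Module.End K V), B a a ≠ 0 → σ μ * μ = 1 → P k →
          P (((1 : Module.End K V) + ((μ - 1) * (B a a)⁻¹) • (B a).smulRight a) * k)) →
        ∀ g : Module.End K V, (∀ x y, B (g x) (g y) = B x y) → P g := by
  intro d
  induction d using Nat.strong_induction_on with
  | _ d IH =>
  intro V _ _ _ hd B hB han P hP1 hPQ g hg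
  classical
  by_cases hV : Module.finrank K V = 0
  · haveI : Subsingleton V := Module.finrank_zero_iff.1 hV
    have : g = 1 := LinearMap.ext fun x => Subsingleton.elim _ _
    rw [this]; exact hP1
  obtain ⟨a, ha0⟩ := (Module.finrank_pos_iff_exists_ne_zero (R := K) (M := V)).1 (Nat.pos_of_ne_zero hV)
  have ha : B a a ≠ 0 := fun h => ha0 (han a h)
  -- the induction step on `a^⊥`: every isometry fixing `a` is in `P`
  have step : ∀ k : Module.End K V, (∀ x y, B (k x) (k y) = B x y) → k a = a → P k := by
    intro k hk hka
    have hc := isCompl_line B a ha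
    obtain ⟨ι, hι₁, hι₂, -⟩ := exists_extension (LinearMap.ker (B a)) (K ∙ a) hc
    have hmap : ∀ w ∈ LinearMap.ker (B a), k w ∈ LinearMap.ker (B a) := by
      intro w hw
      rw [LinearMap.mem_ker] at hw ⊢
      rw [← hka, hk, hw]
    have hkι : k = ι (k.restrict hmap) := by
      refine eq_of_isCompl _ _ hc _ _ (fun w hw => ?_) (fun y hy => ?_)
      · rw [show w = ((⟨w, hw⟩ : LinearMap.ker (B a)) : V) from rfl, hι₁, LinearMap.coe_restrict_apply]
      · obtain ⟨c, rfl⟩ := Submodule.mem_span_singleton.1 hy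
        rw [hι₂ _ _ hy, map_smul, hka]
    have hlt : Module.finrank K (LinearMap.ker (B a)) < d := by
      rw [← hd]
      refine Submodule.finrank_lt fun htop => ha ?_
      have : a ∈ LinearMap.ker (B a) := by rw [htop]; exact Submodule.mem_top
      exact LinearMap.mem_ker.1 this
    have hB₁ : ∀ x y : LinearMap.ker (B a), σ (B.domRestrict₁₂ _ _ x y) = B.domRestrict₁₂ _ _ y x := fun x y => by
      simp only [LinearMap.domRestrict₁₂_apply]; exact hB _ _
    have han₁ : ∀ x : LinearMap.ker (B a), B.domRestrict₁₂ _ _ x x = 0 → x = 0 := fun x hx => by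
      rw [LinearMap.domRestrict₁₂_apply] at hx
      exact Subtype.ext (han _ hx)
    have hP₁ : P (ι 1) := by rw [map_one]; exact hP1
    have hPQ₁ : ∀ (b : LinearMap.ker (B a)) (μ : K) (k' : Module.End K (LinearMap.ker (B a))),
        B.domRestrict₁₂ _ _ b b ≠ 0 → σ μ * μ = 1 → P (ι k') →
        P (ι (((1 : Module.End K (LinearMap.ker (B a))) +
          ((μ - 1) * (B.domRestrict₁₂ _ _ b b)⁻¹) • (B.domRestrict₁₂ _ _ b).smulRight b) * k')) := by
      intro b μ k' hb hμ hk'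
      rw [map_mul, extension_quasi B _ _ hc (orth_line B hB a) ι hι₁ hι₂]
      rw [LinearMap.domRestrict₁₂_apply] at hb
      exact hPQ _ μ _ hb hμ hk'
    have hiso₁ : ∀ x y : LinearMap.ker (B a),
        B.domRestrict₁₂ _ _ (k.restrict hmap x) (k.restrict hmap y) = B.domRestrict₁₂ _ _ x y := fun x y => by
      simp only [LinearMap.domRestrict₁₂_apply, LinearMap.coe_restrict_apply, hk]
    have := IH _ hlt rfl (B.domRestrict₁₂ _ _) hB₁ han₁ (fun k' => P (ι k')) hP₁ hPQ₁ (k.restrict hmap) hiso₁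
    rw [hkι]; exact this
  -- Witt's step: move `x = g a` back to `a` by one or two quasi-symmetries
  set x := g a with hx
  have hxx : B x x = B a a := by rw [hx, hg]
  have hx0 : B x x ≠ 0 := by rw [hxx]; exact ha
  obtain ⟨ε, hεε, hσε, hεu⟩ : ∃ ε : K, ε * ε = 1 ∧ σ ε = ε ∧ B (ε • x - a) (ε • x) ≠ 0 := by
    by_cases h1 : B (x - a) x ≠ 0
    · exact ⟨1, one_mul 1, map_one σ, by rwa [one_smul]⟩
    · refine ⟨-1, by ring, by rw [map_neg, map_one], ?_⟩
      rw [not_not] at h1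
      rw [neg_one_smul, ← neg_add', apply_neg_left, map_neg, neg_neg, apply_add_left]
      rw [apply_sub_left, sub_eq_zero] at h1
      rw [← h1, ← two_mul]
      exact mul_ne_zero h2 hx0
  have hNε : σ ε * ε = 1 := by rw [hσε, hεε]
  have hNσε : σ (σ ε) * σ ε = 1 := by rw [hσ, hσε, hεε]
  have hq₁x : ((1 : Module.End K V) + ((ε - 1) * (B x x)⁻¹) • (B x).smulRight x) x = ε • x :=
    quasi_apply_self B x hx0 ε
  have hq₁ : ∀ y z, B (((1 : Module.End K V) + ((ε - 1) * (B x x)⁻¹) • (B x).smulRight x) y)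
      (((1 : Module.End K V) + ((ε - 1) * (B x x)⁻¹) • (B x).smulRight x) z) = B y z :=
    quasi_isometry B hB x hx0 ε hNε
  have hinv₁ : ((1 : Module.End K V) + ((σ ε - 1) * (B x x)⁻¹) • (B x).smulRight x) *
      ((1 : Module.End K V) + ((ε - 1) * (B x x)⁻¹) • (B x).smulRight x) = 1 := by
    rw [quasi_mul_quasi B x hx0, hNε, quasi_one]
  by_cases hu0 : ε • x - a = 0
  · -- one quasi-symmetry
    have hk : P (((1 : Module.End K V) + ((ε - 1) * (B x x)⁻¹) • (B x).smulRight x) * g) :=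
      step _ (isometry_mul B _ _ hq₁ hg) (by rw [Module.End.mul_apply, ← hx, hq₁x]; exact (sub_eq_zero.1 hu0))
    have := hPQ x (σ ε) _ hx0 hNσε hk
    rwa [← mul_assoc, hinv₁, one_mul] at this
  · -- two quasi-symmetries
    set u := ε • x - a with hu
    have huu : B u u ≠ 0 := fun h => hu0 (han u h)
    have hBuu : B u u = B u (ε • x) - B u a := by rw [hu, map_sub]
    set lam : K := B u a * (B u (ε • x))⁻¹ with hlam
    have hNlam : σ lam * lam = 1 := by
      rw [hlam, map_mul, map_inv₀, hB, hB]
      have hxa : B x a = σ (B a x) := (hB a x).symm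
      have key : B a u * B u a = B (ε • x) u * B u (ε • x) := by
        rw [hu]
        simp only [map_sub, LinearMap.sub_apply, LinearMap.map_smulₛₗ, map_smul, LinearMap.smul_apply, smul_eq_mul,
          hσε, hxx, hxa]
        linear_combination (ε * B a x * B a a + ε * B a a * σ (B a x) - B a a ^ 2 * (1 + ε ^ 2)) * hεε
      have hne : B (ε • x) u ≠ 0 := by
        intro h0; exact hεu (by rw [← hB, h0, map_zero])
      field_simp
      linear_combination key
    have hq₂ : ∀ y z, B (((1 : Module.End K V) + ((lam - 1) * (B u u)⁻¹) • (B u).smulRight u) y)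
        (((1 : Module.End K V) + ((lam - 1) * (B u u)⁻¹) • (B u).smulRight u) z) = B y z :=
      quasi_isometry B hB u huu lam hNlam
    have hq₂x : ((1 : Module.End K V) + ((lam - 1) * (B u u)⁻¹) • (B u).smulRight u) (ε • x) = a := by
      rw [quasi_apply, hlam]
      have hne' : B u (ε • x) - B u a ≠ 0 := by rw [← hBuu]; exact huu
      have : (B u a * (B u (ε • x))⁻¹ - 1) * (B u u)⁻¹ * B u (ε • x) = -1 := by
        rw [hBuu]; field_simp; ring
      rw [this, neg_one_smul, hu]; abel
    have hNσlam : σ (σ lam) * σ lam = 1 := by rw [hσ, mul_comm, hNlam]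
    have hinv₂ : ((1 : Module.End K V) + ((σ lam - 1) * (B u u)⁻¹) • (B u).smulRight u) *
        ((1 : Module.End K V) + ((lam - 1) * (B u u)⁻¹) • (B u).smulRight u) = 1 := by
      rw [quasi_mul_quasi B u huu, hNlam, quasi_one]
    have hk : P (((1 : Module.End K V) + ((lam - 1) * (B u u)⁻¹) • (B u).smulRight u) *
        (((1 : Module.End K V) + ((ε - 1) * (B x x)⁻¹) • (B x).smulRight x) * g)) :=
      step _ (isometry_mul B _ _ hq₂ (isometry_mul B _ _ hq₁ hg))
        (by rw [Module.End.mul_apply, Module.End.mul_apply, ← hx, hq₁x, hq₂x])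
    have h' := hPQ u (σ lam) _ huu hNσlam hk
    rw [← mul_assoc, hinv₂, one_mul] at h'
    have h'' := hPQ x (σ ε) _ hx0 hNσε h'
    rwa [← mul_assoc, hinv₁, one_mul] at h''

/-! ## §11 Anisotropic vectors; quasi-symmetries on `{e,f}^⊥` versus the hyperbolic plane -/

/-- A non-zero non-degenerate hermitian space (involution `σ ≠ 1`, `2 ≠ 0`) has an anisotropic vector. [folklore] -/
private theorem exists_anisotropic (B : V →ₛₗ[σ] V →ₗ[K] K) (hB : ∀ x y, σ (B x y) = B y x)
    (hBnd : ∀ x, (∀ y, B x y = 0) → x = 0) {θ₀ : K} (hθ : σ θ₀ = -θ₀) (hθ0 : θ₀ ≠ 0) (h2 : (2 : K) ≠ 0)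
    (hne : ∃ w : V, w ≠ 0) : ∃ a : V, B a a ≠ 0 := by
  by_contra hall
  push Not at hall
  obtain ⟨w, hw⟩ := hne
  refine hw (hBnd w fun y => ?_)
  have h1 := hall (w + y)
  have h2' := hall (θ₀ • w + y)
  simp only [map_add, LinearMap.map_smulₛₗ, map_smul, LinearMap.add_apply, LinearMap.smul_apply, smul_eq_mul, hall w,
    hall y, hθ, (hB w y).symm] at h1 h2'
  have : (2 * θ₀) * B w y = 0 := by linear_combination θ₀ * h1 - h2'
  exact (mul_eq_zero.1 this).resolve_left (mul_ne_zero h2 hθ0)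

section PlaneQuasi

variable {A : Type*} [CommGroup A] (B : V →ₛₗ[σ] V →ₗ[K] K) (χ : Module.End K V → A)
  (hχ : ∀ g h : Module.End K V, (∀ x y, B (g x) (g y) = B x y) → (∀ x y, B (h x) (h y) = B x y) →
    χ (g * h) = χ g * χ h)
  (hB : ∀ x y, σ (B x y) = B y x) (h2 : (2 : K) ≠ 0)
  {e f : V} {θ₀ : K} (he : B e e = 0) (hf : B f f = 0) (hef : B e f = θ₀) (hθ : σ θ₀ = -θ₀) (hθ0 : θ₀ ≠ 0)
include hχ hB h2 he hf hef hθ hθ0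

/-- **A quasi-symmetry on a vector of `{e, f}^⊥` has the same `χ` as an isometry of the same determinant fixing
`{e, f}^⊥`** (conjugate it into the hyperbolic plane by the reflection along `x_c − a`, `x_c = e + (B a a/2θ₀) f`).
[cite: Dieudonne1971GroupesClassiques, Chap. II §§4–5] -/
theorem exists_fixW_of_quasi [FiniteDimensional K V] (a : V) (ha1 : B e a = 0) (ha2 : B f a = 0) (ha : B a a ≠ 0)
    (μ : K) (hμ : σ μ * μ = 1) :
    ∃ k : Module.End K V, (∀ x y, B (k x) (k y) = B x y) ∧ (∀ w, B e w = 0 → B f w = 0 → k w = w) ∧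
      LinearMap.det k = μ ∧ χ ((1 : Module.End K V) + ((μ - 1) * (B a a)⁻¹) • (B a).smulRight a) = χ k := by
  have hfe := apply_fe B hB hef hθ
  have h2σ : σ 2 = 2 := map_ofNat σ 2
  have haa : σ (B a a) = B a a := hB a a
  obtain ⟨xc, hxc⟩ : ∃ xc : V, xc = e + (B a a * (2 * θ₀)⁻¹) • f := ⟨_, rfl⟩
  have hxcW : ∀ w, B e w = 0 → B f w = 0 → B xc w = 0 := by
    intro w hw1 hw2
    rw [hxc, apply_add_left, apply_smul_left, hw1, hw2, mul_zero, add_zero]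
  have hxcxc : B xc xc = B a a := by
    rw [hxc]
    simp only [map_add, LinearMap.map_smulₛₗ, map_smul, LinearMap.add_apply, LinearMap.smul_apply, smul_eq_mul, map_mul,
      map_inv₀, h2σ, hθ, haa, he, hf, hef, hfe]
    field_simp
    ring
  have hxc0 : B xc xc ≠ 0 := by rw [hxcxc]; exact ha
  have hxca : B xc a = 0 := hxcW a ha1 ha2
  have haxc : B a xc = 0 := apply_eq_zero_comm B hB hxca
  -- the reflection along `u = xc − a`
  have huu : B (xc - a) (xc - a) = 2 * B a a := by
    rw [apply_sub_left, map_sub, map_sub, hxcxc, hxca, haxc]; ring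
  have hu0 : B (xc - a) (xc - a) ≠ 0 := by rw [huu]; exact mul_ne_zero h2 ha
  have hRiso := quasi_isometry B hB (xc - a) hu0 (-1) (by rw [map_neg, map_one]; ring)
  have hRR : ((1 : Module.End K V) + (((-1 : K) - 1) * (B (xc - a) (xc - a))⁻¹) • (B (xc - a)).smulRight (xc - a)) *
      ((1 : Module.End K V) + (((-1 : K) - 1) * (B (xc - a) (xc - a))⁻¹) • (B (xc - a)).smulRight (xc - a)) = 1 := by
    rw [quasi_mul_quasi B _ hu0, show (-1 : K) * -1 = 1 by ring, quasi_one]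
  have hRxc : ((1 : Module.End K V) + (((-1 : K) - 1) * (B (xc - a) (xc - a))⁻¹) • (B (xc - a)).smulRight (xc - a)) xc
      = a := by
    have hBuxc : B (xc - a) xc = B a a := by rw [apply_sub_left, hxcxc, haxc, sub_zero]
    rw [quasi_apply, huu, hBuxc, show ((-1 : K) - 1) * (2 * B a a)⁻¹ * B a a = -1 by field_simp; ring, neg_one_smul]
    abel
  have hconj := conj_quasi B _ _ hRiso hRR xc μ
  rw [hRxc] at hconj
  refine ⟨(1 : Module.End K V) + ((μ - 1) * (B xc xc)⁻¹) • (B xc).smulRight xc, quasi_isometry B hB xc hxc0 μ hμ,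
    fun w hw1 hw2 => quasi_apply_of_orth B xc μ (hxcW w hw1 hw2), det_quasi B xc hxc0 μ, ?_⟩
  rw [← hconj, chi_conj B χ hχ _ _ _ hRiso (quasi_isometry B hB xc hxc0 μ hμ) hRiso hRR]

end PlaneQuasi

/-! ## §12 The theorem: `χ` kills every isometry of determinant `1` of an isotropic space -/

/-- **Main theorem (abstract form).**  `K` a field with `2 ≠ 0`, `σ` an involution of `K` with `σ θ₀ = −θ₀ ≠ 0`,
`B` a non-degenerate `σ`-hermitian form on a finite-dimensional `V` admitting an isotropic vector; then every function
`χ` on `End V` with values in a commutative group which is multiplicative on isometries takes the value `1` on every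
isometry of determinant `1` — i.e. every homomorphism `U(B) → A` factors through `det` (`SU(B) ≤ ker`).
Induction on `dim V` along a hyperbolic pair. [cite: Dieudonne1971GroupesClassiques, Chap. II §5] -/
theorem chi_eq_one_of_det_eq_one (hσ : ∀ x : K, σ (σ x) = x) {θ₀ : K} (hθ : σ θ₀ = -θ₀) (hθ0 : θ₀ ≠ 0)
    (h2 : (2 : K) ≠ 0) {A : Type*} [CommGroup A] :
    ∀ (d : ℕ) {V : Type u} [AddCommGroup V] [Module K V] [FiniteDimensional K V],
      Module.finrank K V = d → ∀ (B : V →ₛₗ[σ] V →ₗ[K] K), (∀ x y, σ (B x y) = B y x) →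
      (∀ x, (∀ y, B x y = 0) → x = 0) → (∃ e : V, e ≠ 0 ∧ B e e = 0) →
      ∀ (χ : Module.End K V → A),
        (∀ g h : Module.End K V, (∀ x y, B (g x) (g y) = B x y) → (∀ x y, B (h x) (h y) = B x y) →
          χ (g * h) = χ g * χ h) →
        ∀ g : Module.End K V, (∀ x y, B (g x) (g y) = B x y) → LinearMap.det g = 1 → χ g = 1 := by
  intro d
  induction d using Nat.strong_induction_on with
  | _ d IH =>
  intro V _ _ _ hd B hB hBnd hiso χ hχ g hg hdet
  classical
  obtain ⟨e, he0, he⟩ := hiso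
  have h2σ : σ 2 = 2 := map_ofNat σ 2
  -- (1) a hyperbolic partner `f`
  obtain ⟨y, hy⟩ : ∃ y, B e y ≠ 0 := by
    by_contra h; push Not at h; exact he0 (hBnd e h)
  obtain ⟨y₁, hy₁⟩ : ∃ y₁ : V, y₁ = (θ₀ * (B e y)⁻¹) • y := ⟨_, rfl⟩
  have hey₁ : B e y₁ = θ₀ := by rw [hy₁, map_smul, smul_eq_mul, inv_mul_cancel_right₀ hy]
  obtain ⟨f, hfdef⟩ : ∃ f : V, f = y₁ + (B y₁ y₁ * (2 * θ₀)⁻¹) • e := ⟨_, rfl⟩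
  have hef : B e f = θ₀ := by rw [hfdef, map_add, map_smul, he, smul_zero, add_zero, hey₁]
  have hf : B f f = 0 := by
    have hy₁e : B y₁ e = -θ₀ := by rw [← hB e y₁, hey₁, hθ]
    rw [hfdef]
    simp only [map_add, LinearMap.map_smulₛₗ, map_smul, LinearMap.add_apply, LinearMap.smul_apply, smul_eq_mul, map_mul,
      map_inv₀, h2σ, hθ, hB y₁ y₁, he, hey₁, hy₁e]
    field_simp
    ring
  have hfe := apply_fe B hB hef hθ
  -- (2) the complement `W = {e, f}^⊥`, the extension `ι`, the restricted form
  set W : Submodule K V := LinearMap.ker (B e) ⊓ LinearMap.ker (B f) with hWdef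
  have hmemW : ∀ {w : V}, w ∈ W ↔ B e w = 0 ∧ B f w = 0 := fun {w} => by
    rw [hWdef, Submodule.mem_inf, LinearMap.mem_ker, LinearMap.mem_ker]
  have hc := isCompl_pair B hB he hf hef hθ hθ0
  have horth : ∀ w ∈ W, ∀ y ∈ Submodule.span K {e, f}, B w y = 0 := orth_pair B hB e f
  obtain ⟨ι, hι₁, hι₂, hιdet⟩ := exists_extension W _ hc
  have hBW : ∀ x y : W, σ (B.domRestrict₁₂ W W x y) = B.domRestrict₁₂ W W y x := fun x y => by
    simp only [LinearMap.domRestrict₁₂_apply]; exact hB _ _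
  have hBWnd : ∀ x : W, (∀ y : W, B.domRestrict₁₂ W W x y = 0) → x = 0 := by
    intro x hx
    have hx2 := hmemW.1 x.2
    refine Subtype.ext (eq_zero_of_orth B hB hBnd he hf hef hθ hθ0 (x : V) hx2.1 hx2.2 fun w hw1 hw2 => ?_)
    have := hx ⟨w, hmemW.2 ⟨hw1, hw2⟩⟩
    rwa [LinearMap.domRestrict₁₂_apply] at this
  have hιiso : ∀ h : Module.End K W, (∀ x y : W, B.domRestrict₁₂ W W (h x) (h y) = B.domRestrict₁₂ W W x y) →
      ∀ x y, B (ι h x) (ι h y) = B x y := fun h hh =>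
    extension_isometry B hB W _ hc horth ι hι₁ hι₂ h (fun x y => by simpa only [LinearMap.domRestrict₁₂_apply] using hh x y)
  have hιW : ∀ (h : Module.End K W) (w : V), B e w = 0 → B f w = 0 → ι h w ∈ W := by
    intro h w hw1 hw2
    rw [show w = ((⟨w, hmemW.2 ⟨hw1, hw2⟩⟩ : W) : V) from rfl, hι₁]
    exact (h _).2
  -- (3) reduction: `g₂ = t' t g` with `g₂ e = p e`, `g₂ f = (σp)⁻¹ f`
  have hge0 : g e ≠ 0 := by
    intro h0
    have := hg e f
    rw [h0, map_zero, LinearMap.zero_apply, hef] at this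
    exact hθ0 this.symm
  obtain ⟨t, ht, htχ, htdet, p, htp⟩ :=
    exists_killed_apply_mem_line B χ hχ hB hσ h2 he hf hef hθ hθ0 hBnd (g e) hge0 (by rw [hg, he])
  obtain ⟨hp, t', ht', ht'χ, ht'det, ht'e, ht'f⟩ :=
    exists_killed_apply_eq_f B χ hχ hB hσ h2 he hf hef hθ hθ0 (t * g) (isometry_mul B _ _ ht hg) p
      (by rw [Module.End.mul_apply, htp])
  have hσp : σ p ≠ 0 := fun h => hp (by simpa [hσ] using congrArg σ h)
  set g₂ := t' * (t * g) with hg₂def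
  have hg₂ : ∀ x y, B (g₂ x) (g₂ y) = B x y := isometry_mul B _ _ ht' (isometry_mul B _ _ ht hg)
  have hg₂e : g₂ e = p • e := by rw [hg₂def, Module.End.mul_apply, Module.End.mul_apply, htp, map_smul, ht'e]
  have hg₂f : g₂ f = (σ p)⁻¹ • f := by rw [hg₂def, Module.End.mul_apply, ht'f]
  have hχg₂ : χ g₂ = χ g := by
    rw [hg₂def, hχ _ _ ht' (isometry_mul B _ _ ht hg), hχ _ _ ht hg, ht'χ, htχ, one_mul, one_mul]
  have hdetg₂ : LinearMap.det g₂ = 1 := by rw [hg₂def, map_mul, map_mul, ht'det, htdet, hdet, one_mul, one_mul]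
  -- (4) the Levi factor: `g₂ = D(p) k`, `k = ι h`
  have hDiso : ∀ α : K, α ≠ 0 → ∀ x y, B (((1 : Module.End K V) + ((1 - α) * θ₀⁻¹) • (B f).smulRight e +
      (((σ α)⁻¹ - 1) * θ₀⁻¹) • (B e).smulRight f) x) (((1 : Module.End K V) + ((1 - α) * θ₀⁻¹) • (B f).smulRight e +
      (((σ α)⁻¹ - 1) * θ₀⁻¹) • (B e).smulRight f) y) = B x y := fun α hα => dil_isometry B hB hσ he hf hef hθ hθ0 α hα
  set k := ((1 : Module.End K V) + ((1 - p⁻¹) * θ₀⁻¹) • (B f).smulRight e +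
      (((σ p⁻¹)⁻¹ - 1) * θ₀⁻¹) • (B e).smulRight f) * g₂ with hkdef
  have hk : ∀ x y, B (k x) (k y) = B x y := isometry_mul B _ _ (hDiso p⁻¹ (inv_ne_zero hp)) hg₂
  have hke : k e = e := by
    rw [hkdef, Module.End.mul_apply, hg₂e, map_smul, dil_apply_e B hB he hef hθ hθ0, smul_smul, mul_inv_cancel₀ hp,
      one_smul]
  have hkf : k f = f := by
    rw [hkdef, Module.End.mul_apply, hg₂f, map_smul, dil_apply_f B hf hef hθ0, smul_smul, map_inv₀, inv_inv,
      inv_mul_cancel₀ hσp, one_smul]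
  have hkW : ∀ w ∈ W, k w ∈ W := by
    intro w hw
    rw [hmemW] at hw ⊢
    constructor
    · rw [← hke, hk, hw.1]
    · rw [← hkf, hk, hw.2]
  set h : Module.End K W := k.restrict hkW with hhdef
  have hkι : k = ι h := by
    refine eq_of_isCompl _ _ hc _ _ (fun w hw => ?_) (fun y hy => ?_)
    · rw [show w = ((⟨w, hw⟩ : W) : V) from rfl, hι₁, hhdef, LinearMap.coe_restrict_apply]
    · obtain ⟨a, b, rfl⟩ := Submodule.mem_span_pair.1 hy
      rw [hι₂ _ _ hy, map_add, map_smul, map_smul, hke, hkf]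
  have hhiso : ∀ x y : W, B.domRestrict₁₂ W W (h x) (h y) = B.domRestrict₁₂ W W x y := fun x y => by
    simp only [LinearMap.domRestrict₁₂_apply, hhdef, LinearMap.coe_restrict_apply, hk]
  have hg₂D : g₂ = ((1 : Module.End K V) + ((1 - p) * θ₀⁻¹) • (B f).smulRight e +
      (((σ p)⁻¹ - 1) * θ₀⁻¹) • (B e).smulRight f) * ι h := by
    rw [← hkι, hkdef, ← mul_assoc, dil_mul_dil B hB he hf hef hθ hθ0, mul_inv_cancel₀ hp, dil_one, one_mul]
  have hDfix : ∀ w, B e w = 0 → B f w = 0 → ((1 : Module.End K V) + ((1 - p) * θ₀⁻¹) • (B f).smulRight e +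
      (((σ p)⁻¹ - 1) * θ₀⁻¹) • (B e).smulRight f) w = w := fun w hw1 hw2 => dil_apply_of_orth B e f θ₀ p hw1 hw2
  have hχg : χ g = χ ((1 : Module.End K V) + ((1 - p) * θ₀⁻¹) • (B f).smulRight e +
      (((σ p)⁻¹ - 1) * θ₀⁻¹) • (B e).smulRight f) * χ (ι h) := by
    rw [← hχg₂, hg₂D, hχ _ _ (hDiso p hp) (hιiso h hhiso)]
  have hdeth : p * (σ p)⁻¹ * LinearMap.det h = 1 := by
    rw [← hιdet, ← det_dil B hB hf hef hθ hθ0 p, ← map_mul, ← hg₂D, hdetg₂]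
  have hNp : σ (p * (σ p)⁻¹) * (p * (σ p)⁻¹) = 1 := by
    rw [map_mul, map_inv₀, hσ]; field_simp
  -- (5) induction on the complement
  by_cases hWiso : ∃ w : W, w ≠ 0 ∧ B.domRestrict₁₂ W W w w = 0
  · -- `W` isotropic: induction hypothesis on `W`
    have hlt : Module.finrank K W < d := by
      rw [← hd]
      refine Submodule.finrank_lt fun htop => hθ0 ?_
      have : e ∈ W := by rw [htop]; exact Submodule.mem_top
      have h' := (hmemW.1 this).2
      rw [hfe, neg_eq_zero] at h'
      exact h'
    have hχW : ∀ g' h' : Module.End K W,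
        (∀ x y : W, B.domRestrict₁₂ W W (g' x) (g' y) = B.domRestrict₁₂ W W x y) →
        (∀ x y : W, B.domRestrict₁₂ W W (h' x) (h' y) = B.domRestrict₁₂ W W x y) →
        χ (ι (g' * h')) = χ (ι g') * χ (ι h') := by
      intro g' h' hg' hh'
      rw [map_mul, hχ _ _ (hιiso g' hg') (hιiso h' hh')]
    have hWne : ∃ w : W, w ≠ 0 := by obtain ⟨w, hw, -⟩ := hWiso; exact ⟨w, hw⟩
    obtain ⟨a, ha⟩ := exists_anisotropic (B.domRestrict₁₂ W W) hBW hBWnd hθ hθ0 h2 hWne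
    have haV : B (a : V) (a : V) ≠ 0 := by rwa [LinearMap.domRestrict₁₂_apply] at ha
    have ha2 := hmemW.1 a.2
    -- the correcting quasi-symmetry on `W`
    set QW : Module.End K W := (1 : Module.End K W) +
      ((p * (σ p)⁻¹ - 1) * (B.domRestrict₁₂ W W a a)⁻¹) • (B.domRestrict₁₂ W W a).smulRight a with hQW
    have hQWiso : ∀ x y : W, B.domRestrict₁₂ W W (QW x) (QW y) = B.domRestrict₁₂ W W x y :=
      quasi_isometry (B.domRestrict₁₂ W W) hBW a ha _ hNp
    have hdet1 : LinearMap.det (QW * h) = 1 := by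
      rw [map_mul, hQW, det_quasi (B.domRestrict₁₂ W W) a ha, hdeth]
    have hIH := IH _ hlt rfl (B.domRestrict₁₂ W W) hBW hBWnd hWiso (fun h' => χ (ι h')) hχW (QW * h)
      (fun x y => by rw [Module.End.mul_apply, Module.End.mul_apply, hQWiso, hhiso]) hdet1
    rw [map_mul, hχ _ _ (hιiso QW hQWiso) (hιiso h hhiso), hQW,
      extension_quasi B W _ hc horth ι hι₁ hι₂ a (p * (σ p)⁻¹)] at hIH
    obtain ⟨kk, hkk, hkkW, hkkdet, hkkχ⟩ :=
      exists_fixW_of_quasi B χ hχ hB h2 he hf hef hθ hθ0 (a : V) ha2.1 ha2.2 haV (p * (σ p)⁻¹) hNp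
    rw [hkkχ] at hIH
    rw [hχg, chi_eq_of_fixW_of_det_eq B χ hχ hB hσ hBnd h2 he hf hef hθ hθ0 _ kk (hDiso p hp) hDfix hkk hkkW
      (by rw [det_dil B hB hf hef hθ hθ0 p, hkkdet]), hIH]
  · -- `W` anisotropic: anisotropic Cartan–Dieudonné on `W`
    push Not at hWiso
    have hanW : ∀ w : W, B.domRestrict₁₂ W W w w = 0 → w = 0 := fun w hw => by
      by_contra h0; exact hWiso w h0 hw
    have hCD := aniso_cartan_dieudonne hσ h2 _ rfl (B.domRestrict₁₂ W W) hBW hanW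
      (fun h' => ∃ kk : Module.End K V, (∀ x y, B (kk x) (kk y) = B x y) ∧
        (∀ w, B e w = 0 → B f w = 0 → kk w = w) ∧ LinearMap.det kk = LinearMap.det (ι h') ∧
        (∀ x y, B (ι h' x) (ι h' y) = B x y) ∧ χ (ι h') = χ kk)
      ⟨1, isometry_one B, fun w _ _ => Module.End.one_apply w, by rw [map_one, map_one, map_one],
        by rw [map_one]; exact isometry_one B, by rw [map_one]⟩
      (by
        rintro b μ k' hb hμ ⟨kk, hkk, hkkW, hkkdet, hk'iso, hkkχ⟩
        have hbV : B (b : V) (b : V) ≠ 0 := by rwa [LinearMap.domRestrict₁₂_apply] at hb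
        have hb2 := hmemW.1 b.2
        obtain ⟨kb, hkb, hkbW, hkbdet, hkbχ⟩ :=
          exists_fixW_of_quasi B χ hχ hB h2 he hf hef hθ hθ0 (b : V) hb2.1 hb2.2 hbV μ hμ
        have hQb := quasi_isometry B hB (b : V) hbV μ hμ
        refine ⟨kb * kk, isometry_mul B _ _ hkb hkk, fun w hw1 hw2 => by
          rw [Module.End.mul_apply, hkkW w hw1 hw2, hkbW w hw1 hw2], ?_, ?_, ?_⟩
        · rw [map_mul, map_mul, extension_quasi B W _ hc horth ι hι₁ hι₂ b μ, map_mul, det_quasi B (b : V) hbV,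
            hkbdet, hkkdet]
        · rw [map_mul, extension_quasi B W _ hc horth ι hι₁ hι₂ b μ]
          exact isometry_mul B _ _ hQb hk'iso
        · rw [map_mul, extension_quasi B W _ hc horth ι hι₁ hι₂ b μ, hχ _ _ hQb hk'iso, hkbχ, hkkχ, hχ _ _ hkb hkk])
      h hhiso
    obtain ⟨kk, hkk, hkkW, hkkdet, -, hkkχ⟩ := hCD
    rw [hχg, hkkχ, ← hχ _ _ (hDiso p hp) hkk]
    refine chi_eq_one_of_fixW B χ hχ hB hσ hBnd h2 he hf hef hθ hθ0 _ (isometry_mul B _ _ (hDiso p hp) hkk)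
      (fun w hw1 hw2 => by rw [Module.End.mul_apply, hkkW w hw1 hw2, hDfix w hw1 hw2]) ?_
    rw [map_mul, hkkdet, ← map_mul, ← hg₂D, hdetg₂]

/-! ## §13 Matrix form: `SU(J) ≤ ker χ` for `unitaryGroupOfForm σ J`, any non-degenerate hermitian `J` of any
finite rank admitting an isotropic vector -/

section MatrixForm

variable {n : Type*} [Fintype n] [DecidableEq n]

/-- The sesquilinear form of `J`: `B_J x y = ᵗσ(x) J y = Σᵢⱼ σ(xᵢ) J i j yⱼ`. [folklore] -/
private theorem toLinearMapₛₗ₂'_apply_eq (J : Matrix n n K) (x y : n → K) :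
    Matrix.toLinearMapₛₗ₂' K σ (RingHom.id K) J x y = dotProduct (fun i => σ (x i)) (J.mulVec y) := by
  rw [Matrix.toLinearMapₛₗ₂'_apply]
  simp only [RingHom.id_apply, smul_eq_mul, dotProduct, Matrix.mulVec, Finset.mul_sum]
  exact Finset.sum_congr rfl fun i _ => Finset.sum_congr rfl fun j _ => by ring

/-- `B_J (M x) (M y) = ᵗσ(x) (ᵗσ(M) J M) y`. [folklore] -/
private theorem form_toLin' (J M : Matrix n n K) (x y : n → K) :
    Matrix.toLinearMapₛₗ₂' K σ (RingHom.id K) J (Matrix.toLin' M x) (Matrix.toLin' M y) =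
      dotProduct (fun i => σ (x i)) (((M.map σ).transpose * J * M).mulVec y) := by
  rw [toLinearMapₛₗ₂'_apply_eq, Matrix.toLin'_apply, Matrix.toLin'_apply]
  have h1 : (fun i => σ ((M.mulVec x) i)) = (M.map σ).mulVec (fun i => σ (x i)) := by
    funext i
    rw [RingHom.map_mulVec]
    rfl
  rw [h1, ← Matrix.vecMul_transpose, ← Matrix.dotProduct_mulVec, Matrix.mulVec_mulVec, Matrix.mulVec_mulVec]

omit [Fintype n] in
/-- `σ` applied to a basis vector `Pi.single i 1` gives it back. [folklore] -/
private theorem sigma_single (i : n) : (fun k => σ (Pi.single (M := fun _ => K) i (1 : K) k)) = Pi.single i 1 := by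
  funext k
  by_cases h : k = i
  · subst h; rw [Pi.single_eq_same, map_one]
  · rw [Pi.single_eq_of_ne h, map_zero]

/-- **Main theorem, matrix form: `SU(J) ≤ ker χ`.**  For a field `K` with `2 ≠ 0`, an involution `σ` with
`σ θ₀ = −θ₀ ≠ 0`, and a non-degenerate `σ`-hermitian matrix `J` of ANY finite size admitting an isotropic vector
(`ᵗσ(x) J x = 0`, `x ≠ 0`), every homomorphism `unitaryGroupOfForm σ J →* A` to a commutative group kills the elements
of determinant `1` — the general-rank form of the tree's rank-3 engine `UnitaryRankThree.apply_eq_one_of_det_eq_one`.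
[cite: Dieudonne1971GroupesClassiques, Chap. II §5] -/
theorem apply_eq_one_of_det_eq_one {A : Type*} [CommGroup A] (hσ : ∀ x : K, σ (σ x) = x) {θ₀ : K}
    (hθ : σ θ₀ = -θ₀) (hθ0 : θ₀ ≠ 0) (h2 : (2 : K) ≠ 0) (J : Matrix n n K) (hJh : (J.map σ).transpose = J)
    (hJdet : J.det ≠ 0) (hiso : ∃ x : n → K, x ≠ 0 ∧ dotProduct (fun i => σ (x i)) (J.mulVec x) = 0)
    (χ : ↥(unitaryGroupOfForm σ J) →* A) (g : ↥(unitaryGroupOfForm σ J)) (hdet : g.1.1.det = 1) : χ g = 1 := by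
  classical
  set B := Matrix.toLinearMapₛₗ₂' K σ (RingHom.id K) J with hBdef
  have hBap : ∀ x y, B x y = dotProduct (fun i => σ (x i)) (J.mulVec y) := toLinearMapₛₗ₂'_apply_eq J
  have hJ' : ∀ i j, σ (J i j) = J j i := by
    intro i j
    have h := congrFun (congrFun hJh j) i
    rw [Matrix.transpose_apply, Matrix.map_apply] at h
    exact h
  -- hermitian
  have hB : ∀ x y, σ (B x y) = B y x := by
    intro x y
    rw [hBap, hBap]
    simp only [dotProduct, Matrix.mulVec, map_sum, map_mul, hσ, hJ', Finset.mul_sum]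
    rw [Finset.sum_comm]
    exact Finset.sum_congr rfl fun i _ => Finset.sum_congr rfl fun j _ => by ring
  -- non-degenerate
  have hBnd : ∀ x, (∀ y, B x y = 0) → x = 0 := by
    intro x hx
    have hv : Matrix.vecMul (fun i => σ (x i)) J = 0 := by
      funext j
      have := hx (Pi.single j 1)
      rwa [hBap, Matrix.dotProduct_mulVec, dotProduct_single, mul_one] at this
    have h0 := Matrix.eq_zero_of_vecMul_eq_zero hJdet hv
    funext i
    have hi := congrFun h0 i
    simp only [Pi.zero_apply] at hi
    rw [← hσ (x i), hi, map_zero]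
    rfl
  -- isotropic
  have hBiso : ∃ e : n → K, e ≠ 0 ∧ B e e = 0 := by
    obtain ⟨x, hx0, hxx⟩ := hiso
    exact ⟨x, hx0, by rw [hBap]; exact hxx⟩
  -- unitarity ↔ isometry
  have hiso_of_mem : ∀ M : Matrix n n K, (M.map σ).transpose * J * M = J →
      ∀ x y, B (Matrix.toLin' M x) (Matrix.toLin' M y) = B x y := by
    intro M hM x y
    rw [hBdef, form_toLin', hM, ← toLinearMapₛₗ₂'_apply_eq]
  have hmem_of_iso : ∀ M : Matrix n n K, (∀ x y, B (Matrix.toLin' M x) (Matrix.toLin' M y) = B x y) →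
      (M.map σ).transpose * J * M = J := by
    intro M hM
    ext i j
    have h := hM (Pi.single i 1) (Pi.single j 1)
    rw [hBdef, form_toLin', toLinearMapₛₗ₂'_apply_eq, sigma_single, single_dotProduct, single_dotProduct, one_mul,
      one_mul, Matrix.mulVec_single_one, Matrix.mulVec_single_one, Matrix.col_apply, Matrix.col_apply] at h
    exact h
  have hdetM : ∀ M : Matrix n n K, (M.map σ).transpose * J * M = J → M.det ≠ 0 := by
    intro M hM hM0
    have h := congrArg Matrix.det hM
    rw [Matrix.det_mul, Matrix.det_mul, hM0, mul_zero] at h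
    exact hJdet h.symm
  -- representatives
  have hrep : ∀ φ : Module.End K (n → K), (∀ x y, B (φ x) (φ y) = B x y) →
      ∃ g' : ↥(unitaryGroupOfForm σ J), Matrix.toLin' g'.1.1 = φ := by
    intro φ hφ
    have hM : ((LinearMap.toMatrix' φ).map σ).transpose * J * LinearMap.toMatrix' φ = J :=
      hmem_of_iso _ (by rw [Matrix.toLin'_toMatrix']; exact hφ)
    refine ⟨⟨Matrix.GeneralLinearGroup.mkOfDetNeZero _ (hdetM _ hM), ?_⟩, ?_⟩
    · rw [mem_unitaryGroupOfForm_iff, Matrix.GeneralLinearGroup.val_mkOfDetNeZero]; exact hM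
    · change Matrix.toLin' ((Matrix.GeneralLinearGroup.mkOfDetNeZero _ (hdetM _ hM) : Matrix n n K)) = φ
      rw [Matrix.GeneralLinearGroup.val_mkOfDetNeZero, Matrix.toLin'_toMatrix']
  have huniq : ∀ g₁ g₂ : ↥(unitaryGroupOfForm σ J), Matrix.toLin' g₁.1.1 = Matrix.toLin' g₂.1.1 → g₁ = g₂ :=
    fun g₁ g₂ h => Subtype.ext (Units.ext (Matrix.toLin'.injective h))
  -- the multiplicative function on `End`
  let χ' : Module.End K (n → K) → A := fun φ =>
    if h : ∃ g' : ↥(unitaryGroupOfForm σ J), Matrix.toLin' g'.1.1 = φ then χ h.choose else 1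
  have hχ'val : ∀ g' : ↥(unitaryGroupOfForm σ J), χ' (Matrix.toLin' g'.1.1) = χ g' := by
    intro g'
    have h : ∃ g'' : ↥(unitaryGroupOfForm σ J), Matrix.toLin' g''.1.1 = Matrix.toLin' g'.1.1 := ⟨g', rfl⟩
    simp only [χ', dif_pos h]
    rw [huniq _ _ h.choose_spec]
  have hχ' : ∀ φ ψ : Module.End K (n → K), (∀ x y, B (φ x) (φ y) = B x y) → (∀ x y, B (ψ x) (ψ y) = B x y) →
      χ' (φ * ψ) = χ' φ * χ' ψ := by
    intro φ ψ hφ hψ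
    obtain ⟨gφ, rfl⟩ := hrep φ hφ
    obtain ⟨gψ, rfl⟩ := hrep ψ hψ
    have : Matrix.toLin' gφ.1.1 * Matrix.toLin' gψ.1.1 = Matrix.toLin' (gφ * gψ).1.1 := by
      rw [Module.End.mul_eq_comp, ← Matrix.toLin'_mul]; rfl
    rw [this, hχ'val, hχ'val, hχ'val, map_mul]
  have key := chi_eq_one_of_det_eq_one hσ hθ hθ0 h2 (Module.finrank K (n → K)) rfl B hB hBnd hBiso χ' hχ'
    (Matrix.toLin' g.1.1) (hiso_of_mem _ g.2) (by rw [LinearMap.det_toLin']; exact hdet)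
  rwa [hχ'val] at key

/-- Hypothesis form for a matrix `M` propositionally equal to `J` (the shape of the tree's local unitary groups, whose
forms are `J.map φ`). [cite: Dieudonne1971GroupesClassiques, Chap. II §5] -/
theorem apply_eq_one_of_det_eq_one' {A : Type*} [CommGroup A] (hσ : ∀ x : K, σ (σ x) = x) {θ₀ : K}
    (hθ : σ θ₀ = -θ₀) (hθ0 : θ₀ ≠ 0) (h2 : (2 : K) ≠ 0) (M J : Matrix n n K) (hM : M = J) (hJh : (J.map σ).transpose = J)
    (hJdet : J.det ≠ 0) (hiso : ∃ x : n → K, x ≠ 0 ∧ dotProduct (fun i => σ (x i)) (J.mulVec x) = 0)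
    (χ : ↥(unitaryGroupOfForm σ M) →* A) (g : ↥(unitaryGroupOfForm σ M)) (hdet : g.1.1.det = 1) : χ g = 1 := by
  subst hM
  exact apply_eq_one_of_det_eq_one hσ hθ hθ0 h2 M hJh hJdet hiso χ g hdet

end MatrixForm

end UnitaryIsotropic

end Literature.NumberTheory.Automorphic
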